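import Literature.MathematicalPhysics.QuantumFieldTheory.Balaban1983to89.B9SectCDiffCutModelToy10

/-!
# `Balaban1983to89.B9SectCDiffCutModelToy11` — THE FIRST `TwoSeq` INHABITANT WITH `∂ ≠ 0` WHOSE TWO SEQUENCES
DIFFER: the POTENTIAL datum `Xpot` (sequence 2 = sequence 1 perturbed by a non-negative diagonal site potential in
the multi-level slot `A′₂`), its nine sequence-2 operators `G′_v, C_v = E_v⁻¹, G_v` by the ENTRYWISE COMPARISON
PRINCIPLE `G′(μ+t) ≤ G′_v ≤ G′(μ)` for dominant Z-matrices, and BOTH per-sequence `(M)` bundles at ONE constant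
`256a⁴` free of `B`, `n`, `N` (census `b2b-balaban-r1/SectC-inst-census.md` §6 (a⁵) ff.; notes N16–N17)

B9 = T. Bałaban, *Propagators for lattice gauge theories in a background field*, Commun. Math. Phys. **99**, 389–434
(1985) [Balaban1985BackgroundPropagators].

CITATION HEADER (lean-in-tree rule 2026-08-18).  Cell `pub-balaban`, unit `b2b-balaban-r1-g18` (READER GROUP A,
lineage r1, gen 18), journal claim `SECTC-DIFF-CUTMODEL-TOY11` (successor of gen 17's `…Toy7` – `…Toy10` under
claims `SECTC-DIFF-CUTMODEL-TOY7` – `…-TOY10`).  Source: doi:10.1007/bf01240355, held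
`paper:balaban1985-cmp99-background-propagators`, journal page = PDF page + 388.  This unit re-read NO page and
introduces NO quotation: the only printed shapes inhabited here are the signature `TwoSeq` of `…B9SectCDiffExpansion`
((3.25)–(3.27), pp. 394–395, quoted VERBATIM in the header of that module — in particular the two multi-level slots
`A′₁`, `A′₂` of the scalar operator `Δ′_a` of (3.25), in which the two local sequences of a cut differ) and the two
per-sequence slot bundles `MOne` (seven slots) / `MTwo` (nine slots) of `…B9SectCDiffAssembly`, which carry the scale
powers of B9's Theorem 3.2 (3.48), p. 398 [PDF 10] (sentence quoted VERBATIM in the header of `…B9SectCDiffAssembly`;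
the classes `𝒟(n, k, c)` transcribe Theorem 3.1 (3.42), p. 397 [PDF 9], quoted in the header of
`…B9SectCDiffEstimate`); the present declarations point to those quotations BY NAME only.  Tree inputs (by name):
`B9SectCDiffEstimate.{OpDec}`, `B9SectCDiffAssembly.{MOne, MTwo}`, `B9SectCDiffExpansion.TwoSeq`,
`B9SectCDiffCutModelToy.{Qp, Qp_rowsum}`, `B9SectCDiffCutModelToy2.Qpt`, `B9SectCDiffCutModelToy3.{toyFrame,
opDec_of_rowsum, opDec_Qpt, opDec_zero_toy}`, `B9SectCDiffCutModelToy4.{Dfw, Dbw}`, `B9SectCDiffCutModelToy5.{IsDomZ,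
IsDomZ.inv_le_of_supersol, IsDomZ.inv_nonneg, IsDomZ.mul_inv, IsDomZ.inv_mul, mulVec_col_apply, Hm, isDomZ_Hm, Gr,
Gr_mul_Hm, Hm_mul_Gr, Gr_nonneg}`, `B9SectCDiffCutModelToy6.{IsWt, RowLe, RowLe.mul, RowLe.inv_of_diag, ewt, isWt_ewt,
opDec_coarse_of_rowLe, E2}`, `B9SectCDiffCutModelToy7.{R1, R1_pos, R1_num_le, odB, odB_num_le, srate_eq, E2_offdiag_weighted_le,
E2_diag_ge_num, rowLe_of_offdiag, rowLe_mono, isUnit_E2_num}`, `B9SectCDiffCutModelToy8.{coarse_apply,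
coarse_nonneg, E3, odB3, MC, MC_apply, MC_offdiag_weighted_le, offmass_num_le, woodbury_mul_eq_one, Lam, G0, G0_mul,
Dbw_G0_Dfw, Gtoy, Gr_hG'_shape, E2inv_hC_shape, Gtoy_mul_eq_one_num}`, `B9SectCDiffCutModelToy9.{siteWt,
isWt_siteWt, rowLe_Gr, RD, RD_nonneg, rowLe_G0, rowLe_DGr, rowLe_GrD, rowLe_add, rowLe_smul, rowLe_coarseLift,
opDec_fine_of_rowLe, qrate_eq, factor_sizes, opDec_toy_mono, Gr_opDec_num}`, `B9SectCDiffCutModelToy10.{rowLe_DbwG0,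
muB_pos, bundle_consts, mOne_of_seq1, Xdiag}`;
Mathlib otherwise.  Cell rows: GAPS C-r1g13-1 (the cut model), C-r1g14-1 … C-r1g17-5 (the toys 1–10), this module's
row C-r1g18-1; census §6 (a⁵) / notes N10–N17.  No `HarnessLib` fact, no named-fact `Prop`, no `instance`, no new
predicate; no `sorry`.

## WHAT THIS MODULE DOES

Toy10's `Xdiag` inhabited `TwoSeq` with `∂ ≠ 0` but with IDENTICAL sequences (their difference vanishes).  B9's cut
model needs two local sequences that DIFFER away from the window; in the signature `TwoSeq` the place where the
sequence-dependent data of the scalar operator live is the pair of multi-level slots `A′₁`, `A′₂`.  This module builds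
the first inhabitant whose sequences genuinely differ, with every sequence-2 estimate reduced to the gen-17 engines of
Toy7/Toy8/Toy9 by ONE idea — the entrywise comparison principle for dominant Z-matrices:

* §1 GENERIC COMPARISON: **`isDomZ_add_diagonal`** (a dominant Z-matrix plus a non-negative diagonal is one),
  **`inv_add_diagonal_le : (A + diag d)⁻¹ ≤ A⁻¹` entrywise** (`d ≥ 0`; Toy5's `IsDomZ.inv_le_of_supersol` with the
  columns of `A⁻¹` as supersolutions), entrywise monotonicity of products of non-negative matrices and of the coarse
  sandwich `Q′·M·Q′*` (`mul_entry_mono`, `coarse_mono`, `offdiag_weighted_mono`), the row-norm transfers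
  `rowLe_of_abs_le`, `rowLe_sub`, `rowLe_diagonal`, and the packaged inverse engine **`isUnit_inv_rowLe_of_dom`**
  (`E ≥ 0`, diagonal `≥ d`, off-diagonal weighted mass `≤ Ω`, `2Ω ≤ d` ⇒ `IsUnit E`, `N_w(E⁻¹) ≤ 2d⁻¹`; Toy6's
  `RowLe.inv_of_diag` on Toy7's `rowLe_of_offdiag`);
* §2 THE POTENTIAL PROPAGATOR: `Hv μ v := H_μ + diag v = ∂*∂ + μ + v`, **`Gv := Hv⁻¹`**, `Gv ≥ 0`, the SANDWICH
  **`Gv_le_Gr : G_v ≤ G′(μ)`** and **`Gr_le_Gv : G′(μ + t) ≤ G_v`** for `0 ≤ v ≤ t` (`Hm_add_eq : H_{μ+t} = Hv + diag(t − v)`),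
  the two resolvent identities `Gv = G′ − G′·diag v·G_v = G′ − G_v·diag v·G′`, the shape `Gv_hG'_shape :
  (∂*∂ + μ·1 + diag v)·G_v = 1` (the field `TwoSeq.hG'₂` at `A′₂ = diag v`), and `Gv_ne_Gr` (`v(x₀) ≠ 0 ⇒ G_v ≠ G′`);
* §3 THE SEQUENCE-2 COARSE OPERATORS `Ev := Q′G_v²Q′*`, `E3v := Q′G_vG′(ν)G_vQ′*`, `MCv := ½(Ev + ν·E3v)`:
  `0 ≤ Ev ≤ E₂(μ)`, `E₂(μ+t) ≤ Ev` (so Toy7's diagonal floor at the DOUBLED mass and Toy7's off-diagonal mass at the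
  original mass both apply), `0 ≤ E3v ≤ E₃`, `MCv ≤ M_C`, `MCv(I,I) ≥ d/2`; hence (parametric) **`isUnit_Ev_inv_rowLe`**,
  **`Ev_inv_opDec : Ev⁻¹ ∈ 𝒟(0, −4, c)`**, **`isUnit_MCv_inv_rowLe`** (`N(MCv⁻¹) ≤ 4d⁻¹`);
* §4 WOODBURY FOR SEQUENCE 2: `VG0Uv_eq : Q′G_v∂*·G₀·∂G_vQ′* = Ev − MCv`, **`Gtoyv := G₀ + G₀·∂G_vQ′*·MCv⁻¹·Q′G_v∂*·G₀`**,
  **`Gtoyv_mul_eq_one`** (the field `hG₂` at `Λ = 2ν + ∂∂*`, `A₂ = 0`, `C₂ = Ev⁻¹`, `G′₂ = G_v`), `Evinv_hC_shape` (the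
  field `hC₂`), and the block-weighted row norms in Toy9's `RowLe (siteWt κ)` algebra: `rowLe_Gv` (`≤ R₁`),
  **`rowLe_DGv`, `rowLe_GvD` (`N(∂G_v), N(G_v∂*) ≤ R_D(1 + t·R₁)`, by the resolvent identities — NO factor `B`)**,
  `rowLe_Gtoyv`, `rowLe_DbwGtoyv` (symbolic, gradient norms as parameters);
* §5 NUMBERS at `κ = 1/2`, `m = l = a/B`, potential cap `t = 3(a/B)²` (so `μ + t = (2a/B)²`, `four_mu_eq`), Λ-mass
  `ν = (a/B)²`: the thresholds `threshold_v1 : 983040a⁴ ≤ (a−1)³(2a−6)²`, `threshold_v2 : 49152000a⁵ ≤ (a−1)⁴(2a−6)²`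
  (`a ≥ 2²⁴`), the diagonal floor `dv := B⁴(2a−6)²/(2a)⁶ ≤ Ev(I,I)` (`Ev_diag_ge_num`, needs `2a ≤ B`), dominance
  `dominance_v1/2`, constants `2dv⁻¹ ≤ 128a⁴B⁻⁴`, `4dv⁻¹ ≤ 256a⁴B⁻⁴`; **`isUnit_Ev_num`, `Ev_inv_opDec_num :
  Ev⁻¹ ∈ 𝒟(0,−4,128a⁴)`**, **`isUnit_MCv_num`**, `Gtoyv_mul_eq_one_num`; sizes `tR1_num_le` (`t·R₁ ≤ 121`),
  `rowLe_DGv_num`/`rowLe_GvD_num` (`≤ 54656·B/a`), `rowLe_Gtoyv_num` (`≤ 13·10¹⁴B²/a²`; `40 + 40·54656·256·54656·40 =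
  1 223 589 206 425 640`), `rowLe_DbwGtoyv_num` (`≤ 7·10¹⁵B/a`); the slot classes `Gv_opDec_num` (`𝒟(0,2,40/(a(a−1)))`),
  `DGv_opDec_num` (`𝒟(0,1,54656/a)`), `Gtoyv_opDec_num` (`𝒟(0,2,13·10¹⁴/a²)`), `DbwGtoyv_opDec_num` (`𝒟(0,1,7·10¹⁵/a)`);
  `bundle_consts_v`: every per-slot constant of both sequences is `≤ 256a⁴` for `a ≥ 2²⁴`;
* §6 `mOne_toy_mono` (validity-free constant monotonicity of the sequence-1 bundle on the toy frame);
* §7 **`Xpot`** — THE POTENTIAL DATUM (parametric in a site potential `0 ≤ v ≤ 3(a/B)²`, `2²⁴ ≤ a`, `2a ≤ B`):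
  sequence 1 = Toy10's genuine operators (`A′₁ = 0`, `G′₁ = G′(μ)`, `C₁ = E₂⁻¹`, `G₁ = Gtoy`), sequence 2 = the
  potential ones (`A′₂ = diag v`, `G′₂ = G_v`, `C₂ = Ev⁻¹`, `G₂ = Gtoyv`), shared `∂ = Dfw`, `∂* = Dbw`, `Λ = Lam(μ)`,
  `Λ′ = μ·1`, `A₁ = A₂ = 0`, `Q = Q′`, `Q* = Q′* = Qpt`, `χ = ψ = 1`; the six inverse identities; projections `Xpot_*`;
  **`mOne_Xpot : MOne … (256a⁴)`** (Toy10's `mOne_of_seq1` by seven `rfl`s, then §6), **`mTwo_Xpot : MTwo … (∇ := 0)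
  (256a⁴)`** (nine slots from §5); the honesty lemmas **`Xpot_A'₂_ne_A'₁`**, **`Xpot_G'₂_ne_G'₁`** (the sequences
  DIFFER as soon as `v ≢ 0`); and the CUT POTENTIAL `vcut t I₀` (`= t` on the blocks left of `I₀`, `0` elsewhere) with
  the instance **`Xcut`**, `Xcut_G'₂_ne_G'₁` (differs whenever a site left of block `I₀` exists),
  `mOne_Xcut`, `mTwo_Xcut`.

## WHAT IS NOT CLAIMED (ABSOLUTE RULE)

Nothing printed is asserted.  Everything here is finite-dimensional linear algebra (M-matrix comparison, resolvent and
Woodbury identities) and finite sums of exponentials over the one-dimensional toy (folklore); B9's Theorems 3.1–3.3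
concern gauge-covariant operators in a background field on a four-dimensional multi-level lattice, and nothing here
bears on them or on their printed proofs.  HONEST CAVEATS: (1) in B9 the sequence-dependent multi-level terms of
`Δ′_a` are averaging penalties of the form `Q′*aQ′` (positive semidefinite, NOT diagonal, NOT of Z-matrix sign); the
toy's stand-in `A′₂ = diag v` is a non-negative DIAGONAL site potential, chosen precisely so that the comparison
principle of §1 applies — a potential marking the left region (`vcut`), not B9's a-terms; (2) the second sequence still
uses the FIRST sequence's averaging `Q′`, `Qpt` and carriers (Toy3's window/left-site averaging `Q2`, `Q2t` on
`S2 = Win ⊕ Lft` is NOT carried — its point rows force a `B`-dependent `mC` constant, census note N17); (3) `∇ := 0`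
(no 2-tensor carrier in `d = 1`) makes `mDvG` trivial; (4) the constant `256a⁴`, the cap `t = 3μ` (so that `μ + t` is
the perfect square `(2a/B)²` and Toy7's closed-form floor can be reused) and the thresholds `a ≥ 2²⁴`, `2a ≤ B` are
artefacts of crude inputs; nothing was optimised; (5) the `(L)` bundle with Toy4's Leibniz block, the zone classes,
`CutModel` and `EstHyp` with `∂ ≠ 0`, an `n`-free majorant profile and the `b = 0` reading are NOT done (census §6
(a⁵) ff., notes N16–N17).  Value = kernel certificate that THEOREM D's per-sequence hypothesis bundles are inhabited,
with `∂ ≠ 0`, ONE absolute constant and two DIFFERENT sequences, by genuine finite-volume operators — NOT summit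
progress.
-/

namespace Literature.MathematicalPhysics.QuantumFieldTheory.Balaban1983to89.B9SectCDiffCutModelToy11

open Finset Real
open B9SectCDiffEstimate
open B9SectCDiffAssembly
open B9SectCDiffExpansion (TwoSeq)
open B9SectCDiffCutModel
open B9SectCDiffCutModelToy
open B9SectCDiffCutModelToy2
open B9SectCDiffCutModelToy3
open B9SectCDiffCutModelToy4
open B9SectCDiffCutModelToy5
open B9SectCDiffCutModelToy6
open B9SectCDiffCutModelToy7
open B9SectCDiffCutModelToy8
open B9SectCDiffCutModelToy9
open B9SectCDiffCutModelToy10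

noncomputable section

/-! ## §1 Generic: comparison of dominant Z-matrices, monotone products, row-norm transfers, the packaged engine -/

section DomZ

variable {α : Type*} [Fintype α] [DecidableEq α]

/-- a dominant Z-matrix plus a NON-NEGATIVE DIAGONAL is a dominant Z-matrix (same off-diagonal entries, larger row
sums). [folklore] -/
theorem isDomZ_add_diagonal {A : Matrix α α ℝ} (hA : IsDomZ A) {d : α → ℝ} (hd : ∀ i, 0 ≤ d i) :
    IsDomZ (A + Matrix.diagonal d) where
  offdiag i j hij := by
    rw [Matrix.add_apply, Matrix.diagonal_apply_ne d hij, add_zero]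
    exact hA.offdiag i j hij
  rowsum i := by
    have e : ∑ j, Matrix.diagonal d i j = d i := by
      rw [Finset.sum_eq_single i (fun j _ h => Matrix.diagonal_apply_ne d (Ne.symm h))
        (fun h => absurd (mem_univ i) h), Matrix.diagonal_apply_eq]
    have e2 : ∑ j, (A + Matrix.diagonal d) i j = ∑ j, A i j + d i := by
      simp only [Matrix.add_apply, sum_add_distrib, e]
    rw [e2]
    linarith [hA.rowsum i, hd i]

/-- **THE COMPARISON PRINCIPLE** (entrywise monotonicity of the inverse in a non-negative diagonal perturbation):
`(A + diag d)⁻¹(i,j) ≤ A⁻¹(i,j)` for a dominant Z-matrix `A` and `d ≥ 0` — the `j`-th column of `A⁻¹ ≥ 0` is a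
supersolution for `A + diag d` (Toy5's `IsDomZ.inv_le_of_supersol`). [folklore] -/
theorem inv_add_diagonal_le {A : Matrix α α ℝ} (hA : IsDomZ A) {d : α → ℝ} (hd : ∀ i, 0 ≤ d i) (i j : α) :
    (A + Matrix.diagonal d)⁻¹ i j ≤ A⁻¹ i j := by
  refine (isDomZ_add_diagonal hA hd).inv_le_of_supersol j (φ := fun k => A⁻¹ k j) (fun i' => ?_) i
  have h := mul_nonneg (hd i') (hA.inv_nonneg i' j)
  rw [Matrix.add_mulVec, Pi.add_apply, mulVec_col_apply A A⁻¹ i' j, hA.mul_inv, Matrix.one_apply,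
    Matrix.mulVec_diagonal]
  split_ifs <;> linarith

omit [DecidableEq α] in
/-- transfer of a weighted row bound along an entrywise domination `|M| ≤ |N|`. [folklore] -/
theorem rowLe_of_abs_le {w : α → α → ℝ} (hw : IsWt w) {M N : Matrix α α ℝ} {q : ℝ} (hN : RowLe w N q)
    (h : ∀ i j, |M i j| ≤ |N i j|) : RowLe w M q :=
  fun i => (sum_le_sum fun j _ => mul_le_mul_of_nonneg_right (h i j) (hw.nonneg i j)).trans (hN i)

omit [DecidableEq α] in
/-- `RowLe` of a difference. [folklore] -/
theorem rowLe_sub {w : α → α → ℝ} (hw : IsWt w) {M N : Matrix α α ℝ} {q r : ℝ} (hM : RowLe w M q)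
    (hN : RowLe w N r) : RowLe w (M - N) (q + r) := by
  have hN' : RowLe w (-N) r := by
    have h := rowLe_smul hN (-1 : ℝ)
    rwa [neg_one_smul, abs_neg, abs_one, one_mul] at h
  rw [sub_eq_add_neg]
  exact rowLe_add hw hM hN'

/-- a diagonal matrix with `|v| ≤ t` has weighted row norm `≤ t` (the weight is `1` on the diagonal). [folklore] -/
theorem rowLe_diagonal {w : α → α → ℝ} (hw : IsWt w) {v : α → ℝ} {t : ℝ} (hv : ∀ i, |v i| ≤ t) :
    RowLe w (Matrix.diagonal v) t := by
  intro i
  rw [Finset.sum_eq_single i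
      (fun j _ h => by rw [Matrix.diagonal_apply_ne v (Ne.symm h), abs_zero, zero_mul])
      (fun h => absurd (mem_univ i) h), Matrix.diagonal_apply_eq, hw.diag, mul_one]
  exact hv i

/-- monotonicity of an off-diagonal weighted row mass in the (non-negatively weighted) entries. [folklore] -/
theorem offdiag_weighted_mono {w : α → α → ℝ} (hw : ∀ i j, 0 ≤ w i j) {E E' : Matrix α α ℝ}
    (h : ∀ i j, E i j ≤ E' i j) (i : α) :
    ∑ j ∈ univ.filter (fun j => j ≠ i), E i j * w i j ≤ ∑ j ∈ univ.filter (fun j => j ≠ i), E' i j * w i j :=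
  sum_le_sum fun j _ => mul_le_mul_of_nonneg_right (h i j) (hw i j)

/-- **THE PACKAGED COARSE-INVERSE ENGINE**: an entrywise non-negative `E` with diagonal `≥ d > 0` and off-diagonal
weighted row mass `≤ Ω` with `2Ω ≤ d` (dominance by a factor two) is invertible with `Σ_j |E⁻¹(i,j)|w(i,j) ≤ 2d⁻¹`
(Toy7's `rowLe_of_offdiag` + Toy6's `RowLe.inv_of_diag` + `(1 − q)⁻¹ ≤ 2` for `q ≤ 1/2`). [folklore] -/
theorem isUnit_inv_rowLe_of_dom {w : α → α → ℝ} (hw : IsWt w) {E : Matrix α α ℝ} {d Ω : ℝ}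
    (hE : ∀ i j, 0 ≤ E i j) (hd : 0 < d) (hD : ∀ i, d ≤ E i i)
    (hΩ : ∀ i, ∑ j ∈ univ.filter (fun j => j ≠ i), E i j * w i j ≤ Ω) (h2 : 2 * Ω ≤ d) :
    IsUnit E ∧ RowLe w E⁻¹ (2 * d⁻¹) := by
  have h := rowLe_of_offdiag hw hE hd hD hΩ
  have hq : Ω / d ≤ 1 / 2 := by rw [div_le_iff₀ hd]; linarith
  obtain ⟨hU, hR⟩ := RowLe.inv_of_diag hw (D := fun i => E i i) hd hD (lt_of_le_of_lt hq (by norm_num)) h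
  refine ⟨hU, rowLe_mono hR (mul_le_mul_of_nonneg_right ?_ (inv_nonneg.mpr hd.le))⟩
  rw [inv_le_comm₀ (by linarith) (by norm_num)]
  linarith

end DomZ

section MulMono

variable {α β γ : Type*} [Fintype β]

/-- a product of entrywise non-negative matrices is entrywise non-negative. [folklore] -/
theorem mul_entry_nonneg {M : Matrix α β ℝ} {N : Matrix β γ ℝ} (hM : ∀ i j, 0 ≤ M i j) (hN : ∀ j k, 0 ≤ N j k)
    (i : α) (k : γ) : 0 ≤ (M * N) i k := by
  rw [Matrix.mul_apply]
  exact sum_nonneg fun j _ => mul_nonneg (hM i j) (hN j k)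

/-- products of entrywise non-negative matrices are entrywise MONOTONE in both factors. [folklore] -/
theorem mul_entry_mono {M M' : Matrix α β ℝ} {N N' : Matrix β γ ℝ} (hM0 : ∀ i j, 0 ≤ M i j)
    (hM : ∀ i j, M i j ≤ M' i j) (hN0 : ∀ j k, 0 ≤ N j k) (hN : ∀ j k, N j k ≤ N' j k) (i : α) (k : γ) :
    (M * N) i k ≤ (M' * N') i k := by
  rw [Matrix.mul_apply, Matrix.mul_apply]
  exact sum_le_sum fun j _ => mul_le_mul (hM i j) (hN j k) (hN0 j k) ((hM0 i j).trans (hM i j))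

end MulMono

section CoarseMono

variable {n B : ℕ}

/-- the coarse sandwich `Q′·M·Q′*` is entrywise monotone in `M` (Toy8's `coarse_apply`). [folklore] -/
theorem coarse_mono {M M' : Matrix (Fin n × Fin B) (Fin n × Fin B) ℝ} (h : ∀ x z, M x z ≤ M' x z) (I J : Fin n) :
    (Qp n B * M * Qpt n B) I J ≤ (Qp n B * M' * Qpt n B) I J := by
  rw [coarse_apply, coarse_apply]
  exact mul_le_mul_of_nonneg_left (sum_le_sum fun x _ => sum_le_sum fun z _ => h x z)
    (inv_nonneg.mpr (Nat.cast_nonneg _))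

end CoarseMono

/-! ## §2 The potential propagator `G_v = (∂*∂ + μ + v)⁻¹` and the sandwich `G′(μ + t) ≤ G_v ≤ G′(μ)` -/

section Potential

variable {n B : ℕ} {μ t : ℝ} {v : Fin n × Fin B → ℝ}

/-- the scalar operator of sequence 2: `H_v := ∂*∂ + μ·1 + diag v` (Toy5's `H_μ` plus a diagonal site potential in
the multi-level slot `A′₂`). OURS (typing). [folklore] -/
def Hv (n B : ℕ) (μ : ℝ) (v : Fin n × Fin B → ℝ) : Matrix (Fin n × Fin B) (Fin n × Fin B) ℝ :=
  Hm n B μ + Matrix.diagonal v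

/-- the POTENTIAL PROPAGATOR `G_v := H_v⁻¹` (the datum `G′₂`). OURS (typing). [folklore] -/
def Gv (n B : ℕ) (μ : ℝ) (v : Fin n × Fin B → ℝ) : Matrix (Fin n × Fin B) (Fin n × Fin B) ℝ := (Hv n B μ v)⁻¹

/-- `H_v` is a dominant Z-matrix for `μ > 0`, `v ≥ 0`. [folklore] -/
theorem isDomZ_Hv (hμ : 0 < μ) (hv : ∀ x, 0 ≤ v x) : IsDomZ (Hv n B μ v) :=
  isDomZ_add_diagonal (isDomZ_Hm hμ) hv

/-- [folklore] -/
theorem Hv_mul_Gv (hμ : 0 < μ) (hv : ∀ x, 0 ≤ v x) : Hv n B μ v * Gv n B μ v = 1 := (isDomZ_Hv hμ hv).mul_inv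

/-- [folklore] -/
theorem Gv_mul_Hv (hμ : 0 < μ) (hv : ∀ x, 0 ≤ v x) : Gv n B μ v * Hv n B μ v = 1 := (isDomZ_Hv hμ hv).inv_mul

/-- `G_v ≥ 0` entrywise. [folklore] -/
theorem Gv_nonneg (hμ : 0 < μ) (hv : ∀ x, 0 ≤ v x) (x y : Fin n × Fin B) : 0 ≤ Gv n B μ v x y :=
  (isDomZ_Hv hμ hv).inv_nonneg x y

/-- **UPPER COMPARISON**: `G_v ≤ G′(μ)` entrywise (`v ≥ 0`). [folklore] -/
theorem Gv_le_Gr (hμ : 0 < μ) (hv : ∀ x, 0 ≤ v x) (x y : Fin n × Fin B) : Gv n B μ v x y ≤ Gr n B μ x y :=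
  inv_add_diagonal_le (isDomZ_Hm hμ) hv x y

/-- `|G_v| ≤ |G′(μ)|` entrywise. [folklore] -/
theorem abs_Gv_le (hμ : 0 < μ) (hv : ∀ x, 0 ≤ v x) (x y : Fin n × Fin B) : |Gv n B μ v x y| ≤ |Gr n B μ x y| := by
  rw [abs_of_nonneg (Gv_nonneg hμ hv x y), abs_of_nonneg (Gr_nonneg hμ x y)]
  exact Gv_le_Gr hμ hv x y

/-- `H_{μ+t} = H_v + diag(t − v)`. [folklore] -/
theorem Hm_add_eq (μ t : ℝ) (v : Fin n × Fin B → ℝ) :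
    Hm n B (μ + t) = Hv n B μ v + Matrix.diagonal (fun x => t - v x) := by
  unfold Hv Hm
  ext x y
  simp only [Matrix.add_apply, Matrix.smul_apply, Matrix.one_apply, Matrix.diagonal_apply, smul_eq_mul]
  split_ifs <;> ring

/-- **LOWER COMPARISON**: `G′(μ + t) ≤ G_v` entrywise for `0 ≤ v ≤ t`. [folklore] -/
theorem Gr_le_Gv (hμ : 0 < μ) (hv0 : ∀ x, 0 ≤ v x) (hv1 : ∀ x, v x ≤ t) (x y : Fin n × Fin B) :
    Gr n B (μ + t) x y ≤ Gv n B μ v x y := by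
  have h := inv_add_diagonal_le (isDomZ_Hv hμ hv0) (d := fun x => t - v x) (fun x => sub_nonneg.mpr (hv1 x)) x y
  rw [← Hm_add_eq] at h
  exact h

/-- the LEFT resolvent identity `G_v = G′ − G′·diag v·G_v`. [folklore] -/
theorem Gv_eq_sub_left (hμ : 0 < μ) (hv : ∀ x, 0 ≤ v x) :
    Gv n B μ v = Gr n B μ - Gr n B μ * Matrix.diagonal v * Gv n B μ v := by
  have e : Hm n B μ = Hv n B μ v - Matrix.diagonal v := by unfold Hv; rw [add_sub_cancel_right]
  calc Gv n B μ v = Gr n B μ * Hm n B μ * Gv n B μ v := by rw [Gr_mul_Hm hμ, Matrix.one_mul]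
    _ = Gr n B μ * (Hv n B μ v - Matrix.diagonal v) * Gv n B μ v := by rw [e]
    _ = Gr n B μ * Hv n B μ v * Gv n B μ v - Gr n B μ * Matrix.diagonal v * Gv n B μ v := by
        rw [Matrix.mul_sub, Matrix.sub_mul]
    _ = Gr n B μ - Gr n B μ * Matrix.diagonal v * Gv n B μ v := by
        rw [Matrix.mul_assoc (Gr n B μ) (Hv n B μ v), Hv_mul_Gv hμ hv, Matrix.mul_one]

/-- the RIGHT resolvent identity `G_v = G′ − G_v·diag v·G′`. [folklore] -/
theorem Gv_eq_sub_right (hμ : 0 < μ) (hv : ∀ x, 0 ≤ v x) :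
    Gv n B μ v = Gr n B μ - Gv n B μ v * Matrix.diagonal v * Gr n B μ := by
  have e : Hm n B μ = Hv n B μ v - Matrix.diagonal v := by unfold Hv; rw [add_sub_cancel_right]
  calc Gv n B μ v = Gv n B μ v * (Hm n B μ * Gr n B μ) := by rw [Hm_mul_Gr hμ, Matrix.mul_one]
    _ = Gv n B μ v * ((Hv n B μ v - Matrix.diagonal v) * Gr n B μ) := by rw [e]
    _ = Gv n B μ v * Hv n B μ v * Gr n B μ - Gv n B μ v * Matrix.diagonal v * Gr n B μ := by
        rw [Matrix.sub_mul, Matrix.mul_sub, Matrix.mul_assoc, Matrix.mul_assoc]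
    _ = Gr n B μ - Gv n B μ v * Matrix.diagonal v * Gr n B μ := by rw [Gv_mul_Hv hμ hv, Matrix.one_mul]

/-- the `hG'₂` SHAPE of the potential sequence: `(∂*∂ + μ·1 + diag v)·G_v = 1` (the field `TwoSeq.hG'₂` at
`Λ′ = μ·1`, `A′₂ = diag v`). [folklore] -/
theorem Gv_hG'_shape (hμ : 0 < μ) (hv : ∀ x, 0 ≤ v x) :
    (Dbw n B * Dfw n B + μ • (1 : Matrix (Fin n × Fin B) (Fin n × Fin B) ℝ) + Matrix.diagonal v)
      * Gv n B μ v = 1 :=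
  Hv_mul_Gv hμ hv

/-- **THE SEQUENCES DIFFER**: if `v(x₀) ≠ 0` then `G_v ≠ G′(μ)` (else `diag v·G′ = 0`, so the `x₀`-th row of `G′`
vanishes, contradicting `G′H = 1`). [folklore] -/
theorem Gv_ne_Gr (hμ : 0 < μ) (hv : ∀ x, 0 ≤ v x) {x₀ : Fin n × Fin B} (hx : v x₀ ≠ 0) :
    Gv n B μ v ≠ Gr n B μ := by
  intro h
  have e1 : Hv n B μ v * Gr n B μ = 1 := by rw [← h]; exact Hv_mul_Gv hμ hv
  have e2 : Matrix.diagonal v * Gr n B μ = 0 := by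
    calc Matrix.diagonal v * Gr n B μ = (Hm n B μ + Matrix.diagonal v) * Gr n B μ - Hm n B μ * Gr n B μ := by
          rw [Matrix.add_mul, add_sub_cancel_left]
      _ = 0 := by rw [show Hm n B μ + Matrix.diagonal v = Hv n B μ v from rfl, e1, Hm_mul_Gr hμ, sub_self]
  have e3 : ∀ y, Gr n B μ x₀ y = 0 := fun y => by
    have h3 := congrFun (congrFun e2 x₀) y
    rw [Matrix.diagonal_mul, Matrix.zero_apply] at h3
    exact (mul_eq_zero.mp h3).resolve_left hx
  have e4 := congrFun (congrFun (Gr_mul_Hm (n := n) (B := B) hμ) x₀) x₀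
  rw [Matrix.mul_apply, Matrix.one_apply_eq] at e4
  simp only [e3, zero_mul, sum_const_zero] at e4
  exact zero_ne_one e4

end Potential

/-! ## §3 The coarse operators of sequence 2: `E_v`, `E₃,v`, `M_C,v`; comparison with Toy7/Toy8; inverse classes -/

section CoarseV

variable {n B : ℕ} {N : Finset (Fin n)} {hN : N.Nonempty} {δ₀ : ℝ} {μ ν t m l κ : ℝ} {v : Fin n × Fin B → ℝ}

/-- the coarse operator of sequence 2: `E_v := Q′·G_v²·Q′*` (the datum `C₂` is `E_v⁻¹`). OURS (typing). [folklore] -/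
def Ev (n B : ℕ) (μ : ℝ) (v : Fin n × Fin B → ℝ) : Matrix (Fin n) (Fin n) ℝ :=
  Qp n B * (Gv n B μ v * Gv n B μ v) * Qpt n B

/-- the second coarse operator of sequence 2's Woodbury form: `E₃,v := Q′·G_v·G′(ν)·G_v·Q′*`. OURS (typing).
[folklore] -/
def E3v (n B : ℕ) (μ ν : ℝ) (v : Fin n × Fin B → ℝ) : Matrix (Fin n) (Fin n) ℝ :=
  Qp n B * (Gv n B μ v * Gr n B ν * Gv n B μ v) * Qpt n B

/-- the Woodbury coarse operator of sequence 2: `M_C,v := ½(E_v + ν·E₃,v)`. OURS (typing). [folklore] -/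
def MCv (n B : ℕ) (μ ν : ℝ) (v : Fin n × Fin B → ℝ) : Matrix (Fin n) (Fin n) ℝ :=
  (1 / 2 : ℝ) • (Ev n B μ v + ν • E3v n B μ ν v)

/-- `G_v² ≥ 0` entrywise. [folklore] -/
theorem GvGv_nonneg (hμ : 0 < μ) (hv : ∀ x, 0 ≤ v x) (x z : Fin n × Fin B) :
    0 ≤ (Gv n B μ v * Gv n B μ v) x z :=
  mul_entry_nonneg (Gv_nonneg hμ hv) (Gv_nonneg hμ hv) x z

/-- `G_v² ≤ G′(μ)²` entrywise. [folklore] -/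
theorem GvGv_le (hμ : 0 < μ) (hv : ∀ x, 0 ≤ v x) (x z : Fin n × Fin B) :
    (Gv n B μ v * Gv n B μ v) x z ≤ (Gr n B μ * Gr n B μ) x z :=
  mul_entry_mono (Gv_nonneg hμ hv) (Gv_le_Gr hμ hv) (Gv_nonneg hμ hv) (Gv_le_Gr hμ hv) x z

/-- `G′(μ+t)² ≤ G_v²` entrywise (`0 ≤ v ≤ t`, `0 ≤ t`). [folklore] -/
theorem GrGr_le_GvGv (hμ : 0 < μ) (ht : 0 ≤ t) (hv0 : ∀ x, 0 ≤ v x) (hv1 : ∀ x, v x ≤ t) (x z : Fin n × Fin B) :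
    (Gr n B (μ + t) * Gr n B (μ + t)) x z ≤ (Gv n B μ v * Gv n B μ v) x z :=
  have hμt : 0 < μ + t := by linarith
  mul_entry_mono (Gr_nonneg hμt) (Gr_le_Gv hμ hv0 hv1) (Gr_nonneg hμt) (Gr_le_Gv hμ hv0 hv1) x z

/-- `E_v ≥ 0` entrywise. [folklore] -/
theorem Ev_nonneg (hμ : 0 < μ) (hv : ∀ x, 0 ≤ v x) (I J : Fin n) : 0 ≤ Ev n B μ v I J :=
  coarse_nonneg (GvGv_nonneg hμ hv) I J

/-- **`E_v ≤ E₂(μ)`** entrywise — so Toy7's off-diagonal mass bound applies to `E_v`. [folklore] -/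
theorem Ev_le_E2 (hμ : 0 < μ) (hv : ∀ x, 0 ≤ v x) (I J : Fin n) : Ev n B μ v I J ≤ E2 n B μ I J :=
  coarse_mono (GvGv_le hμ hv) I J

/-- **`E₂(μ + t) ≤ E_v`** entrywise — so Toy7's diagonal floor at the LARGER mass applies to `E_v`. [folklore] -/
theorem E2_le_Ev (hμ : 0 < μ) (ht : 0 ≤ t) (hv0 : ∀ x, 0 ≤ v x) (hv1 : ∀ x, v x ≤ t) (I J : Fin n) :
    E2 n B (μ + t) I J ≤ Ev n B μ v I J :=
  coarse_mono (GrGr_le_GvGv hμ ht hv0 hv1) I J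

/-- the off-diagonal weighted row mass of `E_v` at `μ = m²`: `≤ odB(m)` (domination by `E₂`). [folklore] -/
theorem Ev_offdiag_weighted_le (hm0 : 0 < m) (hm1 : m ≤ 1) (hκ : 0 ≤ κ) (hB : 0 < B) (hs : 0 < m / 2 - κ / B)
    (hv : ∀ x, 0 ≤ v x) (I : Fin n) :
    ∑ J ∈ univ.filter (fun J : Fin n => J ≠ I), Ev n B (m ^ 2) v I J * ewt n κ I J ≤ odB B m κ :=
  (offdiag_weighted_mono (isWt_ewt hκ).nonneg (Ev_le_E2 (by positivity) hv) I).trans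
    (E2_offdiag_weighted_le hm0 hm1 hκ hB hs I)

/-- `G_v·G′(ν)·G_v ≥ 0` entrywise. [folklore] -/
theorem GKGv_nonneg (hμ : 0 < μ) (hν : 0 < ν) (hv : ∀ x, 0 ≤ v x) (x z : Fin n × Fin B) :
    0 ≤ (Gv n B μ v * Gr n B ν * Gv n B μ v) x z :=
  mul_entry_nonneg (mul_entry_nonneg (Gv_nonneg hμ hv) (Gr_nonneg hν)) (Gv_nonneg hμ hv) x z

/-- `G_v·G′(ν)·G_v ≤ G′(μ)·G′(ν)·G′(μ)` entrywise. [folklore] -/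
theorem GKGv_le (hμ : 0 < μ) (hν : 0 < ν) (hv : ∀ x, 0 ≤ v x) (x z : Fin n × Fin B) :
    (Gv n B μ v * Gr n B ν * Gv n B μ v) x z ≤ (Gr n B μ * Gr n B ν * Gr n B μ) x z :=
  mul_entry_mono (mul_entry_nonneg (Gv_nonneg hμ hv) (Gr_nonneg hν))
    (mul_entry_mono (Gv_nonneg hμ hv) (Gv_le_Gr hμ hv) (Gr_nonneg hν) (fun _ _ => le_rfl))
    (Gv_nonneg hμ hv) (Gv_le_Gr hμ hv) x z

/-- `E₃,v ≥ 0` entrywise. [folklore] -/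
theorem E3v_nonneg (hμ : 0 < μ) (hν : 0 < ν) (hv : ∀ x, 0 ≤ v x) (I J : Fin n) : 0 ≤ E3v n B μ ν v I J :=
  coarse_nonneg (GKGv_nonneg hμ hν hv) I J

/-- `E₃,v ≤ E₃` entrywise. [folklore] -/
theorem E3v_le_E3 (hμ : 0 < μ) (hν : 0 < ν) (hv : ∀ x, 0 ≤ v x) (I J : Fin n) :
    E3v n B μ ν v I J ≤ E3 n B μ ν I J :=
  coarse_mono (GKGv_le hμ hν hv) I J

/-- the entries of `M_C,v`. [folklore] -/
theorem MCv_apply (μ ν : ℝ) (v : Fin n × Fin B → ℝ) (I J : Fin n) :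
    MCv n B μ ν v I J = 1 / 2 * (Ev n B μ v I J + ν * E3v n B μ ν v I J) := by
  simp only [MCv, Matrix.smul_apply, Matrix.add_apply, smul_eq_mul]

/-- `M_C,v ≥ 0` entrywise. [folklore] -/
theorem MCv_nonneg (hμ : 0 < μ) (hν : 0 < ν) (hv : ∀ x, 0 ≤ v x) (I J : Fin n) : 0 ≤ MCv n B μ ν v I J := by
  rw [MCv_apply]
  exact mul_nonneg (by norm_num)
    (add_nonneg (Ev_nonneg hμ hv I J) (mul_nonneg hν.le (E3v_nonneg hμ hν hv I J)))

/-- **`M_C,v ≤ M_C`** entrywise — so Toy8's off-diagonal mass bound applies. [folklore] -/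
theorem MCv_le_MC (hμ : 0 < μ) (hν : 0 < ν) (hv : ∀ x, 0 ≤ v x) (I J : Fin n) :
    MCv n B μ ν v I J ≤ MC n B μ ν I J := by
  rw [MCv_apply, MC_apply]
  have h1 := Ev_le_E2 (n := n) (B := B) hμ hv I J
  have h2 := mul_le_mul_of_nonneg_left (E3v_le_E3 (n := n) (B := B) hμ hν hv I J) hν.le
  linarith

/-- the diagonal of `M_C,v` from below comes free from `E_v`'s: `E_v(I,I) ≥ d ⇒ M_C,v(I,I) ≥ d/2`. [folklore] -/
theorem MCv_diag_ge (hμ : 0 < μ) (hν : 0 < ν) (hv : ∀ x, 0 ≤ v x) {d : ℝ} {I : Fin n}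
    (hD : d ≤ Ev n B μ v I I) : d / 2 ≤ MCv n B μ ν v I I := by
  rw [MCv_apply]
  have := mul_nonneg hν.le (E3v_nonneg (n := n) (B := B) hμ hν hv I I)
  linarith

/-- the off-diagonal weighted row mass of `M_C,v` at `μ = m²`, `ν = l²`: `≤ ½(odB + l²·odB3)`. [folklore] -/
theorem MCv_offdiag_weighted_le (hm0 : 0 < m) (hm1 : m ≤ 1) (hl0 : 0 < l) (hl1 : l ≤ 1) (hκ : 0 ≤ κ) (hB : 0 < B)
    (hsm : 0 < m / 2 - κ / B) (hsl : 0 < l / 2 - κ / B) (hv : ∀ x, 0 ≤ v x) (I : Fin n) :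
    ∑ J ∈ univ.filter (fun J : Fin n => J ≠ I), MCv n B (m ^ 2) (l ^ 2) v I J * ewt n κ I J
      ≤ 1 / 2 * (odB B m κ + l ^ 2 * odB3 B m l κ) :=
  (offdiag_weighted_mono (isWt_ewt hκ).nonneg (MCv_le_MC (by positivity) (by positivity) hv) I).trans
    (MC_offdiag_weighted_le hm0 hm1 hl0 hl1 hκ hB hsm hsl I)

/-- **`E_v` IS INVERTIBLE WITH EXPONENTIALLY WEIGHTED ROW BOUNDS** (parametric): at `μ = m²`, with `E_v(I,I) ≥ d > 0`
and `2·odB(m) ≤ d`: `IsUnit E_v` and `Σ_J |E_v⁻¹(I,J)|e^{κ|I−J|} ≤ 2d⁻¹`. [folklore] -/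
theorem isUnit_Ev_inv_rowLe (hm0 : 0 < m) (hm1 : m ≤ 1) (hκ : 0 ≤ κ) (hB : 0 < B) (hs : 0 < m / 2 - κ / B)
    (hv : ∀ x, 0 ≤ v x) {d : ℝ} (hd : 0 < d) (hD : ∀ I : Fin n, d ≤ Ev n B (m ^ 2) v I I)
    (h2 : 2 * odB B m κ ≤ d) :
    IsUnit (Ev n B (m ^ 2) v) ∧ RowLe (ewt n κ) (Ev n B (m ^ 2) v)⁻¹ (2 * d⁻¹) :=
  isUnit_inv_rowLe_of_dom (isWt_ewt hκ) (Ev_nonneg (by positivity) hv) hd hD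
    (Ev_offdiag_weighted_le hm0 hm1 hκ hB hs hv) h2

/-- **THE SEQUENCE-2 COARSE INVERSE IN ITS CLASS** (parametric): with `2·odB ≤ d ≤ E_v(I,I)` and `2d⁻¹ ≤ c·B⁻⁴`,
`0 ≤ κ`, `δ₀ ≤ κ`: `E_v⁻¹ ∈ 𝒟(0, −4, c)` on the toy frame — the SHAPE `MTwo.mC`. [folklore] -/
theorem Ev_inv_opDec (hm0 : 0 < m) (hm1 : m ≤ 1) (hκ : 0 ≤ κ) (hB : 0 < B) (hs : 0 < m / 2 - κ / B)
    (hδ : δ₀ ≤ κ) (hv : ∀ x, 0 ≤ v x) {d c : ℝ} (hd : 0 < d) (hD : ∀ I : Fin n, d ≤ Ev n B (m ^ 2) v I I)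
    (h2 : 2 * odB B m κ ≤ d) (hc : 2 * d⁻¹ ≤ c * (B : ℝ) ^ (-4 : ℤ)) :
    OpDec (toyFrame n B N hN δ₀) id id id id 0 (-4) c (Ev n B (m ^ 2) v)⁻¹ := by
  obtain ⟨-, hR⟩ := isUnit_Ev_inv_rowLe hm0 hm1 hκ hB hs hv hd hD h2
  have hB4 : (0 : ℝ) < (B : ℝ) ^ (-4 : ℤ) := zpow_pos (by exact_mod_cast hB) _
  have hc0 : 0 ≤ c := by
    refine le_of_mul_le_mul_right ?_ hB4
    rw [zero_mul]
    exact le_trans (by positivity) hc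
  exact opDec_coarse_of_rowLe hκ hδ hR hc0 hc

/-- **`M_C,v` IS INVERTIBLE WITH EXPONENTIALLY WEIGHTED ROW BOUNDS** (parametric): at `μ = m²`, `ν = l²`, with
`E_v(I,I) ≥ d > 0` and `2(odB + l²odB3) ≤ d`: `IsUnit M_C,v` and `Σ_J |M_C,v⁻¹(I,J)|e^{κ|I−J|} ≤ 4d⁻¹`. [folklore] -/
theorem isUnit_MCv_inv_rowLe (hm0 : 0 < m) (hm1 : m ≤ 1) (hl0 : 0 < l) (hl1 : l ≤ 1) (hκ : 0 ≤ κ) (hB : 0 < B)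
    (hsm : 0 < m / 2 - κ / B) (hsl : 0 < l / 2 - κ / B) (hv : ∀ x, 0 ≤ v x) {d : ℝ} (hd : 0 < d)
    (hD : ∀ I : Fin n, d ≤ Ev n B (m ^ 2) v I I) (h2 : 2 * (odB B m κ + l ^ 2 * odB3 B m l κ) ≤ d) :
    IsUnit (MCv n B (m ^ 2) (l ^ 2) v) ∧ RowLe (ewt n κ) (MCv n B (m ^ 2) (l ^ 2) v)⁻¹ (4 * d⁻¹) := by
  have hμ : 0 < m ^ 2 := by positivity
  have hν : 0 < l ^ 2 := by positivity
  have hd2 : 0 < d / 2 := by positivity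
  obtain ⟨hU, hR⟩ := isUnit_inv_rowLe_of_dom (isWt_ewt hκ) (MCv_nonneg hμ hν hv) hd2
    (fun I => MCv_diag_ge hμ hν hv (hD I)) (MCv_offdiag_weighted_le hm0 hm1 hl0 hl1 hκ hB hsm hsl hv) (by linarith)
  have e : (2 : ℝ) * (d / 2)⁻¹ = 4 * d⁻¹ := by
    field_simp; ring
  rw [e] at hR
  exact ⟨hU, hR⟩

end CoarseV

/-! ## §4 Woodbury for sequence 2, the shapes `hC₂`, `hG₂`, and the block-weighted row norms -/

section WoodburyV

variable {n B : ℕ} {μ ν m l t κ : ℝ} {v : Fin n × Fin B → ℝ}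

/-- **THE COARSE OPERATOR OF SEQUENCE 2's WOODBURY FORM IS `M_C,v`**: with `U := ∂G_vQ′*`, `V := Q′G_v∂*`,
`VG₀U = ½E_v − (ν/2)E₃,v = E_v − M_C,v` (Toy8's `Dbw_G0_Dfw`). [folklore] -/
theorem VG0Uv_eq (hν : 0 < ν) (μ : ℝ) (v : Fin n × Fin B → ℝ) :
    Qp n B * Gv n B μ v * Dbw n B * G0 n B ν * (Dfw n B * Gv n B μ v * Qpt n B)
      = Ev n B μ v - MCv n B μ ν v := by
  calc Qp n B * Gv n B μ v * Dbw n B * G0 n B ν * (Dfw n B * Gv n B μ v * Qpt n B)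
      = Qp n B * Gv n B μ v * (Dbw n B * G0 n B ν * Dfw n B) * (Gv n B μ v * Qpt n B) := by
        simp only [Matrix.mul_assoc]
    _ = Qp n B * Gv n B μ v * ((1 / 2 : ℝ) • (1 - ν • Gr n B ν)) * (Gv n B μ v * Qpt n B) := by
        rw [Dbw_G0_Dfw hν]
    _ = Ev n B μ v - MCv n B μ ν v := by
        unfold MCv Ev E3v
        simp only [Matrix.mul_smul, Matrix.smul_mul, Matrix.mul_sub, Matrix.sub_mul, Matrix.mul_one,
          Matrix.mul_assoc, smul_sub, smul_add, smul_smul]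
        ext I J
        simp only [Matrix.sub_apply, Matrix.add_apply, Matrix.smul_apply, smul_eq_mul]
        ring

/-- **THE SEQUENCE-2 DATUM IN CLOSED FORM**: `G_v,toy := G₀ + G₀·∂G_vQ′*·M_C,v⁻¹·Q′G_v∂*·G₀`. OURS (typing).
[folklore] -/
def Gtoyv (n B : ℕ) (μ ν : ℝ) (v : Fin n × Fin B → ℝ) : Matrix (Fin n × Fin B) (Fin n × Fin B) ℝ :=
  G0 n B ν + G0 n B ν * (Dfw n B * Gv n B μ v * Qpt n B) * (MCv n B μ ν v)⁻¹
    * (Qp n B * Gv n B μ v * Dbw n B) * G0 n B ν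

/-- **THE `hG₂` SHAPE OF THE POTENTIAL SEQUENCE** (parametric): if `E_v` and `M_C,v` are invertible then
`G_v,toy·(Λ + 0 + ∂(1 − G_vQ′*E_v⁻¹Q′G_v)∂*) = 1` with `Λ = 2ν + ∂∂*` (`woodbury_mul_eq_one` + `VG0Uv_eq`). [folklore] -/
theorem Gtoyv_mul_eq_one (hν : 0 < ν) (hE : IsUnit (Ev n B μ v)) (hM : IsUnit (MCv n B μ ν v)) :
    Gtoyv n B μ ν v * (Lam n B ν + 0
      + Dfw n B * (1 - Gv n B μ v * Qpt n B * (Ev n B μ v)⁻¹ * Qp n B * Gv n B μ v) * Dbw n B) = 1 := by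
  have hEC : Ev n B μ v * (Ev n B μ v)⁻¹ = 1 :=
    Matrix.mul_nonsing_inv _ ((Matrix.isUnit_iff_isUnit_det _).mp hE)
  have hMi : (MCv n B μ ν v)⁻¹ * MCv n B μ ν v = 1 :=
    Matrix.nonsing_inv_mul _ ((Matrix.isUnit_iff_isUnit_det _).mp hM)
  have key := woodbury_mul_eq_one (G0_mul hν) hEC (VG0Uv_eq hν μ v) hMi
  have e : Lam n B ν + 0 + Dfw n B * (1 - Gv n B μ v * Qpt n B * (Ev n B μ v)⁻¹ * Qp n B * Gv n B μ v) * Dbw n B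
      = Lam n B ν + Dfw n B * Dbw n B
        - Dfw n B * Gv n B μ v * Qpt n B * (Ev n B μ v)⁻¹ * (Qp n B * Gv n B μ v * Dbw n B) := by
    rw [add_zero, Matrix.mul_sub, Matrix.sub_mul, Matrix.mul_one]
    simp only [Matrix.mul_assoc]
    abel
  unfold Gtoyv
  rw [e]
  exact key

/-- the `hC₂` SHAPE of the potential sequence: `(Q′G_vG_vQ′*)·E_v⁻¹ = 1`. [folklore] -/
theorem Evinv_hC_shape (hE : IsUnit (Ev n B μ v)) :
    Qp n B * Gv n B μ v * Gv n B μ v * Qpt n B * (Ev n B μ v)⁻¹ = 1 := by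
  have e : Qp n B * Gv n B μ v * Gv n B μ v * Qpt n B = Ev n B μ v := by
    unfold Ev; simp only [Matrix.mul_assoc]
  rw [e]
  exact Matrix.mul_nonsing_inv _ ((Matrix.isUnit_iff_isUnit_det _).mp hE)

/-- `G_v(m²)` has block-weighted row norm `≤ R₁(m)` (domination by `G′`). [folklore] -/
theorem rowLe_Gv (hm0 : 0 < m) (hm1 : m ≤ 1) (hκ : 0 ≤ κ) (hB : 0 < B) (hs : 0 < m / 2 - κ / B)
    (hv : ∀ x, 0 ≤ v x) : RowLe (siteWt n B κ) (Gv n B (m ^ 2) v) (R1 B m κ) :=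
  rowLe_of_abs_le (isWt_siteWt hκ) (rowLe_Gr hm0 hm1 hκ hB hs) (abs_Gv_le (by positivity) hv)

/-- **`N(∂G_v) ≤ R_D(m)·(1 + t·R₁(m))`** for `0 ≤ v ≤ t` — by the LEFT resolvent identity
`∂G_v = ∂G′ − (∂G′)·diag v·G_v`, no factor `B`. [folklore] -/
theorem rowLe_DGv (hm0 : 0 < m) (hm1 : m ≤ 1) (hκ : 0 ≤ κ) (hB : 0 < B) (hs4 : 0 < m / 4 - κ / B)
    (hs : 0 < m / 2 - κ / B) (hv0 : ∀ x, 0 ≤ v x) (hv1 : ∀ x, v x ≤ t) (ht : 0 ≤ t) :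
    RowLe (siteWt n B κ) (Dfw n B * Gv n B (m ^ 2) v) (RD B m κ * (1 + t * R1 B m κ)) := by
  have hμ : 0 < m ^ 2 := by positivity
  have hw := isWt_siteWt (n := n) (B := B) hκ
  have hA := rowLe_DGr (n := n) hm0 hm1 hκ hB hs4
  have hG := rowLe_Gv (n := n) hm0 hm1 hκ hB hs hv0
  have hdg : RowLe (siteWt n B κ) (Matrix.diagonal v) t :=
    rowLe_diagonal hw fun x => by rw [abs_of_nonneg (hv0 x)]; exact hv1 x
  have hR1 : 0 ≤ R1 B m κ := (R1_pos hm0 hs).le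
  have e : Dfw n B * Gv n B (m ^ 2) v
      = Dfw n B * Gr n B (m ^ 2) - Dfw n B * Gr n B (m ^ 2) * Matrix.diagonal v * Gv n B (m ^ 2) v := by
    nth_rw 1 [Gv_eq_sub_left hμ hv0]
    rw [Matrix.mul_sub]
    simp only [Matrix.mul_assoc]
  rw [e]
  refine rowLe_mono (rowLe_sub hw hA (RowLe.mul hw (RowLe.mul hw hA hdg ht) hG hR1)) (le_of_eq ?_)
  ring

/-- **`N(G_v∂*) ≤ R_D(m)·(1 + t·R₁(m))`** — by the RIGHT resolvent identity `G_v∂* = G′∂* − G_v·diag v·(G′∂*)`.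
[folklore] -/
theorem rowLe_GvD (hm0 : 0 < m) (hm1 : m ≤ 1) (hκ : 0 ≤ κ) (hB : 0 < B) (hs4 : 0 < m / 4 - κ / B)
    (hs : 0 < m / 2 - κ / B) (hv0 : ∀ x, 0 ≤ v x) (hv1 : ∀ x, v x ≤ t) (ht : 0 ≤ t) :
    RowLe (siteWt n B κ) (Gv n B (m ^ 2) v * Dbw n B) (RD B m κ * (1 + t * R1 B m κ)) := by
  have hμ : 0 < m ^ 2 := by positivity
  have hw := isWt_siteWt (n := n) (B := B) hκ
  have hC := rowLe_GrD (n := n) hm0 hm1 hκ hB hs4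
  have hG := rowLe_Gv (n := n) hm0 hm1 hκ hB hs hv0
  have hdg : RowLe (siteWt n B κ) (Matrix.diagonal v) t :=
    rowLe_diagonal hw fun x => by rw [abs_of_nonneg (hv0 x)]; exact hv1 x
  have hRD : 0 ≤ RD B m κ := RD_nonneg hs4
  have e : Gv n B (m ^ 2) v * Dbw n B
      = Gr n B (m ^ 2) * Dbw n B - Gv n B (m ^ 2) v * Matrix.diagonal v * (Gr n B (m ^ 2) * Dbw n B) := by
    nth_rw 1 [Gv_eq_sub_right hμ hv0]
    rw [Matrix.sub_mul]
    simp only [Matrix.mul_assoc]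
  rw [e]
  refine rowLe_mono (rowLe_sub hw hC (RowLe.mul hw (RowLe.mul hw hG hdg ht) hC hRD)) (le_of_eq ?_)
  ring

/-- `G_v,toy` as a sum of products of five SQUARE fine factors. [folklore] -/
theorem Gtoyv_eq_prod (μ ν : ℝ) (v : Fin n × Fin B → ℝ) :
    Gtoyv n B μ ν v = G0 n B ν + G0 n B ν * (Dfw n B * Gv n B μ v) * (Qpt n B * (MCv n B μ ν v)⁻¹ * Qp n B)
      * (Gv n B μ v * Dbw n B) * G0 n B ν := by
  unfold Gtoyv; simp only [Matrix.mul_assoc]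

/-- `∂*G_v,toy` as a sum of products of square fine factors. [folklore] -/
theorem Dbw_Gtoyv_eq_prod (μ ν : ℝ) (v : Fin n × Fin B → ℝ) :
    Dbw n B * Gtoyv n B μ ν v = Dbw n B * G0 n B ν + Dbw n B * G0 n B ν * (Dfw n B * Gv n B μ v)
      * (Qpt n B * (MCv n B μ ν v)⁻¹ * Qp n B) * (Gv n B μ v * Dbw n B) * G0 n B ν := by
  rw [Gtoyv_eq_prod, Matrix.mul_add]; simp only [Matrix.mul_assoc]

/-- **THE BLOCK-WEIGHTED ROW NORM OF `G_v,toy`** (symbolic): with `N(∂G_v), N(G_v∂*) ≤ R_v` and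
`N_ewt(M_C,v⁻¹) ≤ R_M`: `N(G_v,toy) ≤ R₁(l)/2 + (R₁(l)/2)·R_v·R_M·R_v·(R₁(l)/2)`. [folklore] -/
theorem rowLe_Gtoyv (hl0 : 0 < l) (hl1 : l ≤ 1) (hκ : 0 ≤ κ) (hB : 0 < B) (hsl : 0 < l / 2 - κ / B)
    {Rv RM : ℝ} (hDG : RowLe (siteWt n B κ) (Dfw n B * Gv n B μ v) Rv)
    (hGD : RowLe (siteWt n B κ) (Gv n B μ v * Dbw n B) Rv) (hRv : 0 ≤ Rv) (hRM : 0 ≤ RM)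
    (hMC : RowLe (ewt n κ) (MCv n B μ (l ^ 2) v)⁻¹ RM) :
    RowLe (siteWt n B κ) (Gtoyv n B μ (l ^ 2) v)
      (R1 B l κ / 2 + R1 B l κ / 2 * Rv * RM * Rv * (R1 B l κ / 2)) := by
  have hw := isWt_siteWt (n := n) (B := B) hκ
  have hG0 := rowLe_G0 (n := n) hl0 hl1 hκ hB hsl
  have hL := rowLe_coarseLift hB hMC
  have hR1 : 0 ≤ R1 B l κ / 2 := by have := R1_pos (B := B) hl0 hsl; positivity
  rw [Gtoyv_eq_prod]
  exact rowLe_add hw hG0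
    (RowLe.mul hw (RowLe.mul hw (RowLe.mul hw (RowLe.mul hw hG0 hDG hRv) hL hRM) hGD hRv) hG0 hR1)

/-- **THE BLOCK-WEIGHTED ROW NORM OF `∂*G_v,toy`** (symbolic):
`N(∂*G_v,toy) ≤ R_D(l)/2 + (R_D(l)/2)·R_v·R_M·R_v·(R₁(l)/2)`. [folklore] -/
theorem rowLe_DbwGtoyv (hl0 : 0 < l) (hl1 : l ≤ 1) (hκ : 0 ≤ κ) (hB : 0 < B) (hsl4 : 0 < l / 4 - κ / B)
    (hsl : 0 < l / 2 - κ / B) {Rv RM : ℝ} (hDG : RowLe (siteWt n B κ) (Dfw n B * Gv n B μ v) Rv)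
    (hGD : RowLe (siteWt n B κ) (Gv n B μ v * Dbw n B) Rv) (hRv : 0 ≤ Rv) (hRM : 0 ≤ RM)
    (hMC : RowLe (ewt n κ) (MCv n B μ (l ^ 2) v)⁻¹ RM) :
    RowLe (siteWt n B κ) (Dbw n B * Gtoyv n B μ (l ^ 2) v)
      (RD B l κ / 2 + RD B l κ / 2 * Rv * RM * Rv * (R1 B l κ / 2)) := by
  have hw := isWt_siteWt (n := n) (B := B) hκ
  have hD0 := rowLe_DbwG0 (n := n) hl0 hl1 hκ hB hsl4
  have hG0 := rowLe_G0 (n := n) hl0 hl1 hκ hB hsl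
  have hL := rowLe_coarseLift hB hMC
  have hR1 : 0 ≤ R1 B l κ / 2 := by have := R1_pos (B := B) hl0 hsl; positivity
  rw [Dbw_Gtoyv_eq_prod]
  exact rowLe_add hw hD0
    (RowLe.mul hw (RowLe.mul hw (RowLe.mul hw (RowLe.mul hw hD0 hDG hRv) hL hRM) hGD hRv) hG0 hR1)

end WoodburyV

/-! ## §5 Numbers at `κ = 1/2`, `m = l = a/B`, potential cap `t = 3(a/B)²`, `2²⁴ ≤ a`, `2a ≤ B` -/

section NumericV

variable {n B : ℕ} {N : Finset (Fin n)} {hN : N.Nonempty} {δ₀ a : ℝ} {v : Fin n × Fin B → ℝ}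

/-- the perfect square: `(a/B)² + 3(a/B)² = (2a/B)²`. [folklore] -/
theorem four_mu_eq (a : ℝ) (B : ℕ) : (a / B) ^ 2 + 3 * (a / B) ^ 2 = (2 * a / B) ^ 2 := by ring

/-- the diagonal floor of sequence 2: `d_v := B⁴(2a−6)²/(2a)⁶` (Toy7's floor at the doubled mass). OURS (typing).
[folklore] -/
def dv (B : ℕ) (a : ℝ) : ℝ := (B : ℝ) ^ 4 * (2 * a - 6) ^ 2 / (2 * a) ^ 6

/-- `d_v > 0` for `3 < a`, `0 < B`. [folklore] -/
theorem dv_pos (ha : 3 < a) (hBr : (0 : ℝ) < B) : 0 < dv B a := by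
  unfold dv
  exact div_pos (mul_pos (by positivity) (pow_pos (by linarith) 2)) (pow_pos (by linarith) 6)

/-- **THE DIAGONAL FLOOR OF `E_v`**: `d_v ≤ E_v((a/B)²)(I,I)` for `0 ≤ v ≤ 3(a/B)²`, `3 ≤ a`, `2a ≤ B`
(`E₂((2a/B)²) ≤ E_v` and Toy7's `E2_diag_ge_num` at `2a`). [folklore] -/
theorem Ev_diag_ge_num (ha : 3 ≤ a) (haB : 2 * a ≤ (B : ℝ)) (hv0 : ∀ x, 0 ≤ v x)
    (hv1 : ∀ x, v x ≤ 3 * (a / B) ^ 2) (I : Fin n) : dv B a ≤ Ev n B ((a / B) ^ 2) v I I := by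
  have ha0 : 0 < a := by linarith
  have hBr : (0 : ℝ) < B := by linarith
  have hμ : 0 < (a / B) ^ 2 := by positivity
  have h1 := E2_diag_ge_num (n := n) (a := 2 * a) (by linarith) haB I
  have h2 := E2_le_Ev (n := n) (B := B) hμ (by positivity) hv0 hv1 I I
  rw [four_mu_eq] at h2
  exact h1.trans h2

/-- the first threshold polynomial inequality: `983040a⁴ ≤ (a−1)³(2a−6)²` for `a ≥ 2²⁴`. [folklore] -/
theorem threshold_v1 (ha : 16777216 ≤ a) : 983040 * a ^ 4 ≤ (a - 1) ^ 3 * (2 * a - 6) ^ 2 := by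
  have h0 : 0 ≤ 255 / 256 * a := by linarith
  have h0' : 0 ≤ 255 / 128 * a := by linarith
  have h1 : 255 / 256 * a ≤ a - 1 := by linarith
  have h2 : 255 / 128 * a ≤ 2 * a - 6 := by linarith
  have h3 : (255 / 256 * a) ^ 3 ≤ (a - 1) ^ 3 := pow_le_pow_left₀ h0 h1 3
  have h4 : (255 / 128 * a) ^ 2 ≤ (2 * a - 6) ^ 2 := pow_le_pow_left₀ h0' h2 2
  have h5 : (255 / 256 * a) ^ 3 * (255 / 128 * a) ^ 2 ≤ (a - 1) ^ 3 * (2 * a - 6) ^ 2 :=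
    mul_le_mul h3 h4 (by positivity) (pow_nonneg (by linarith) 3)
  have h6 : 983040 * a ^ 4 ≤ (255 / 256 * a) ^ 3 * (255 / 128 * a) ^ 2 := by
    have e : (255 / 256 * a) ^ 3 * (255 / 128 * a) ^ 2 = (255 / 256) ^ 3 * (255 / 128) ^ 2 * a * a ^ 4 := by ring
    rw [e]
    have ha4 : 0 ≤ a ^ 4 := by positivity
    have h7 : (983040 : ℝ) ≤ (255 / 256) ^ 3 * (255 / 128) ^ 2 * a := by nlinarith
    nlinarith
  linarith

/-- the second threshold polynomial inequality: `49152000a⁵ ≤ (a−1)⁴(2a−6)²` for `a ≥ 2²⁴`. [folklore] -/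
theorem threshold_v2 (ha : 16777216 ≤ a) : 49152000 * a ^ 5 ≤ (a - 1) ^ 4 * (2 * a - 6) ^ 2 := by
  have h0 : 0 ≤ 255 / 256 * a := by linarith
  have h0' : 0 ≤ 255 / 128 * a := by linarith
  have h1 : 255 / 256 * a ≤ a - 1 := by linarith
  have h2 : 255 / 128 * a ≤ 2 * a - 6 := by linarith
  have h3 : (255 / 256 * a) ^ 4 ≤ (a - 1) ^ 4 := pow_le_pow_left₀ h0 h1 4
  have h4 : (255 / 128 * a) ^ 2 ≤ (2 * a - 6) ^ 2 := pow_le_pow_left₀ h0' h2 2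
  have h5 : (255 / 256 * a) ^ 4 * (255 / 128 * a) ^ 2 ≤ (a - 1) ^ 4 * (2 * a - 6) ^ 2 :=
    mul_le_mul h3 h4 (by positivity) (pow_nonneg (by linarith) 4)
  have h6 : 49152000 * a ^ 5 ≤ (255 / 256 * a) ^ 4 * (255 / 128 * a) ^ 2 := by
    have e : (255 / 256 * a) ^ 4 * (255 / 128 * a) ^ 2 = (255 / 256) ^ 4 * (255 / 128) ^ 2 * a * a ^ 5 := by ring
    rw [e]
    have ha5 : 0 ≤ a ^ 5 := by positivity
    have h7 : (49152000 : ℝ) ≤ (255 / 256) ^ 4 * (255 / 128) ^ 2 * a := by nlinarith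
    nlinarith
  linarith

/-- **DOMINANCE OF `E_v` BY A FACTOR TWO**: `2·(7680B⁴/(a²(a−1)³)) ≤ d_v` for `a ≥ 2²⁴`. [folklore] -/
theorem dominance_v1 (ha : 16777216 ≤ a) (hBr : (0 : ℝ) < B) :
    2 * (7680 * (B : ℝ) ^ 4 / (a ^ 2 * (a - 1) ^ 3)) ≤ dv B a := by
  have ha0 : 0 < a := by linarith
  have ha1 : 0 < a - 1 := by linarith
  have ha1' : a - 1 ≠ 0 := ha1.ne'
  have hP : 15360 * a ^ 4 ≤ (a - 1) ^ 3 * (2 * a - 6) ^ 2 / 64 := by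
    rw [le_div_iff₀ (by norm_num)]; linarith [threshold_v1 ha]
  have hX : 0 ≤ (B : ℝ) ^ 4 / (a ^ 6 * (a - 1) ^ 3) :=
    div_nonneg (by positivity) (mul_nonneg (by positivity) (pow_nonneg ha1.le 3))
  have e1 : 2 * (7680 * (B : ℝ) ^ 4 / (a ^ 2 * (a - 1) ^ 3))
      = (15360 * a ^ 4) * ((B : ℝ) ^ 4 / (a ^ 6 * (a - 1) ^ 3)) := by
    field_simp; ring
  have e2 : dv B a = ((a - 1) ^ 3 * (2 * a - 6) ^ 2 / 64) * ((B : ℝ) ^ 4 / (a ^ 6 * (a - 1) ^ 3)) := by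
    unfold dv; field_simp; ring
  rw [e1, e2]
  exact mul_le_mul_of_nonneg_right hP hX

/-- **DOMINANCE OF `M_C,v` BY A FACTOR TWO**: `2·(384000B⁴/(a(a−1)⁴)) ≤ d_v` for `a ≥ 2²⁴`. [folklore] -/
theorem dominance_v2 (ha : 16777216 ≤ a) (hBr : (0 : ℝ) < B) :
    2 * (384000 * (B : ℝ) ^ 4 / (a * (a - 1) ^ 4)) ≤ dv B a := by
  have ha0 : 0 < a := by linarith
  have ha1 : 0 < a - 1 := by linarith
  have ha1' : a - 1 ≠ 0 := ha1.ne'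
  have hP : 768000 * a ^ 5 ≤ (a - 1) ^ 4 * (2 * a - 6) ^ 2 / 64 := by
    rw [le_div_iff₀ (by norm_num)]; linarith [threshold_v2 ha]
  have hX : 0 ≤ (B : ℝ) ^ 4 / (a ^ 6 * (a - 1) ^ 4) := by positivity
  have e1 : 2 * (384000 * (B : ℝ) ^ 4 / (a * (a - 1) ^ 4))
      = (768000 * a ^ 5) * ((B : ℝ) ^ 4 / (a ^ 6 * (a - 1) ^ 4)) := by
    field_simp; ring
  have e2 : dv B a = ((a - 1) ^ 4 * (2 * a - 6) ^ 2 / 64) * ((B : ℝ) ^ 4 / (a ^ 6 * (a - 1) ^ 4)) := by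
    unfold dv; field_simp; ring
  rw [e1, e2]
  exact mul_le_mul_of_nonneg_right hP hX

/-- **THE `mC` CONSTANT OF SEQUENCE 2**: `2·d_v⁻¹ ≤ 128a⁴·B⁻⁴` for `a ≥ 6` (`a² ≤ (2a−6)²`). [folklore] -/
theorem constant_v1 (ha : 6 ≤ a) (hBr : (0 : ℝ) < B) : 2 * (dv B a)⁻¹ ≤ 128 * a ^ 4 * (B : ℝ) ^ (-4 : ℤ) := by
  have ha0 : 0 < a := by linarith
  have h26 : 0 < 2 * a - 6 := by linarith
  have h26' : 2 * a - 6 ≠ 0 := h26.ne'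
  have hsq : a ^ 2 ≤ (2 * a - 6) ^ 2 := pow_le_pow_left₀ ha0.le (by linarith) 2
  have key : 2 * (2 * a) ^ 6 ≤ 128 * a ^ 4 * (2 * a - 6) ^ 2 := by
    calc 2 * (2 * a) ^ 6 = 128 * a ^ 4 * a ^ 2 := by ring
      _ ≤ 128 * a ^ 4 * (2 * a - 6) ^ 2 := mul_le_mul_of_nonneg_left hsq (by positivity)
  unfold dv
  rw [zpow_neg, zpow_ofNat]
  calc 2 * ((B : ℝ) ^ 4 * (2 * a - 6) ^ 2 / (2 * a) ^ 6)⁻¹ = 2 * (2 * a) ^ 6 / ((B : ℝ) ^ 4 * (2 * a - 6) ^ 2) := by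
        field_simp
    _ ≤ 128 * a ^ 4 * (2 * a - 6) ^ 2 / ((B : ℝ) ^ 4 * (2 * a - 6) ^ 2) :=
        div_le_div_of_nonneg_right key (by positivity)
    _ = 128 * a ^ 4 * ((B : ℝ) ^ 4)⁻¹ := by rw [mul_div_mul_right _ _ (pow_ne_zero 2 h26'), div_eq_mul_inv]

/-- the `M_C,v⁻¹` size in plain form: `4·d_v⁻¹ ≤ 256a⁴/B⁴` for `a ≥ 6`. [folklore] -/
theorem RMv_le (ha : 6 ≤ a) (hBr : (0 : ℝ) < B) : 4 * (dv B a)⁻¹ ≤ 256 * a ^ 4 / (B : ℝ) ^ 4 := by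
  have ha0 : 0 < a := by linarith
  have h26 : 0 < 2 * a - 6 := by linarith
  have h26' : 2 * a - 6 ≠ 0 := h26.ne'
  have hsq : a ^ 2 ≤ (2 * a - 6) ^ 2 := pow_le_pow_left₀ ha0.le (by linarith) 2
  have key : 4 * (2 * a) ^ 6 ≤ 256 * a ^ 4 * (2 * a - 6) ^ 2 := by
    calc 4 * (2 * a) ^ 6 = 256 * a ^ 4 * a ^ 2 := by ring
      _ ≤ 256 * a ^ 4 * (2 * a - 6) ^ 2 := mul_le_mul_of_nonneg_left hsq (by positivity)
  unfold dv
  calc 4 * ((B : ℝ) ^ 4 * (2 * a - 6) ^ 2 / (2 * a) ^ 6)⁻¹ = 4 * (2 * a) ^ 6 / ((B : ℝ) ^ 4 * (2 * a - 6) ^ 2) := by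
        field_simp
    _ ≤ 256 * a ^ 4 * (2 * a - 6) ^ 2 / ((B : ℝ) ^ 4 * (2 * a - 6) ^ 2) :=
        div_le_div_of_nonneg_right key (by positivity)
    _ = 256 * a ^ 4 / (B : ℝ) ^ 4 := by rw [mul_div_mul_right _ _ (pow_ne_zero 2 h26')]

/-- the `M_C,v⁻¹` constant: `4·d_v⁻¹ ≤ 256a⁴·B⁻⁴` for `a ≥ 6`. [folklore] -/
theorem constant_v2 (ha : 6 ≤ a) (hBr : (0 : ℝ) < B) : 4 * (dv B a)⁻¹ ≤ 256 * a ^ 4 * (B : ℝ) ^ (-4 : ℤ) := by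
  rw [zpow_neg, zpow_ofNat, ← div_eq_mul_inv]
  exact RMv_le ha hBr

/-- **`E_v((a/B)²)` IS INVERTIBLE** for `2²⁴ ≤ a`, `2a ≤ B`, `0 ≤ v ≤ 3(a/B)²`, with
`Σ_J |E_v⁻¹(I,J)|e^{|I−J|/2} ≤ 2d_v⁻¹`. [folklore] -/
theorem isUnit_Ev_num (ha : 16777216 ≤ a) (haB : 2 * a ≤ (B : ℝ)) (hv0 : ∀ x, 0 ≤ v x)
    (hv1 : ∀ x, v x ≤ 3 * (a / B) ^ 2) :
    IsUnit (Ev n B ((a / B) ^ 2) v) ∧ RowLe (ewt n (1 / 2)) (Ev n B ((a / B) ^ 2) v)⁻¹ (2 * (dv B a)⁻¹) := by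
  have ha0 : 0 < a := by linarith
  have ha1 : 1 < a := by linarith
  have haB' : a ≤ (B : ℝ) := by linarith
  have hBr : (0 : ℝ) < B := by linarith
  have hB : 0 < B := by exact_mod_cast hBr
  have hm0 : 0 < a / B := by positivity
  have hm1 : a / B ≤ 1 := by rwa [div_le_one hBr]
  have hs : 0 < a / B / 2 - 1 / 2 / (B : ℝ) := by
    rw [srate_eq]; have : 0 < a - 1 := by linarith
    positivity
  exact isUnit_Ev_inv_rowLe hm0 hm1 (by norm_num) hB hs hv0 (dv_pos (by linarith) hBr)
    (fun I => Ev_diag_ge_num (by linarith) haB hv0 hv1 I)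
    (le_trans (mul_le_mul_of_nonneg_left (odB_num_le ha1 haB') zero_le_two) (dominance_v1 ha hBr))

/-- **THE SEQUENCE-2 COARSE INVERSE OF THE TOY IN ITS CLASS**: for `2²⁴ ≤ a`, `2a ≤ B`, `0 ≤ v ≤ 3(a/B)²` and
`δ₀ ≤ 1/2`, `C₂ := E_v((a/B)²)⁻¹ ∈ 𝒟(0, −4, 128a⁴)` on `toyFrame n B N hN δ₀` — constants free of `B`, `n`, `N`
and of the potential `v`. [folklore] -/
theorem Ev_inv_opDec_num (ha : 16777216 ≤ a) (haB : 2 * a ≤ (B : ℝ)) (hv0 : ∀ x, 0 ≤ v x)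
    (hv1 : ∀ x, v x ≤ 3 * (a / B) ^ 2) (hδ : δ₀ ≤ 1 / 2) :
    OpDec (toyFrame n B N hN δ₀) id id id id 0 (-4) (128 * a ^ 4) (Ev n B ((a / B) ^ 2) v)⁻¹ := by
  have ha0 : 0 < a := by linarith
  have ha1 : 1 < a := by linarith
  have haB' : a ≤ (B : ℝ) := by linarith
  have hBr : (0 : ℝ) < B := by linarith
  have hB : 0 < B := by exact_mod_cast hBr
  have hm0 : 0 < a / B := by positivity
  have hm1 : a / B ≤ 1 := by rwa [div_le_one hBr]
  have hs : 0 < a / B / 2 - 1 / 2 / (B : ℝ) := by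
    rw [srate_eq]; have : 0 < a - 1 := by linarith
    positivity
  exact Ev_inv_opDec hm0 hm1 (by norm_num) hB hs hδ hv0 (dv_pos (by linarith) hBr)
    (fun I => Ev_diag_ge_num (by linarith) haB hv0 hv1 I)
    (le_trans (mul_le_mul_of_nonneg_left (odB_num_le ha1 haB') zero_le_two) (dominance_v1 ha hBr))
    (constant_v1 (by linarith) hBr)

/-- **`M_C,v((a/B)², (a/B)²)` IS INVERTIBLE** for `2²⁴ ≤ a`, `2a ≤ B`, `0 ≤ v ≤ 3(a/B)²`, with
`Σ_J |M_C,v⁻¹(I,J)|e^{|I−J|/2} ≤ 4d_v⁻¹`. [folklore] -/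
theorem isUnit_MCv_num (ha : 16777216 ≤ a) (haB : 2 * a ≤ (B : ℝ)) (hv0 : ∀ x, 0 ≤ v x)
    (hv1 : ∀ x, v x ≤ 3 * (a / B) ^ 2) :
    IsUnit (MCv n B ((a / B) ^ 2) ((a / B) ^ 2) v)
      ∧ RowLe (ewt n (1 / 2)) (MCv n B ((a / B) ^ 2) ((a / B) ^ 2) v)⁻¹ (4 * (dv B a)⁻¹) := by
  have ha0 : 0 < a := by linarith
  have ha1 : 1 < a := by linarith
  have haB' : a ≤ (B : ℝ) := by linarith
  have hBr : (0 : ℝ) < B := by linarith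
  have hB : 0 < B := by exact_mod_cast hBr
  have hm0 : 0 < a / B := by positivity
  have hm1 : a / B ≤ 1 := by rwa [div_le_one hBr]
  have hs : 0 < a / B / 2 - 1 / 2 / (B : ℝ) := by
    rw [srate_eq]; have : 0 < a - 1 := by linarith
    positivity
  exact isUnit_MCv_inv_rowLe hm0 hm1 hm0 hm1 (by norm_num) hB hs hs hv0 (dv_pos (by linarith) hBr)
    (fun I => Ev_diag_ge_num (by linarith) haB hv0 hv1 I)
    (le_trans (mul_le_mul_of_nonneg_left (offmass_num_le ha1 haB') zero_le_two) (dominance_v2 ha hBr))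

/-- **NUMERIC `hG₂` SHAPE**: for `2²⁴ ≤ a`, `2a ≤ B`, `0 ≤ v ≤ 3(a/B)²`, at `μ = ν = (a/B)²`, the Woodbury identity of
the potential sequence holds with `C₂ = E_v⁻¹`, `G′₂ = G_v`, `G₂ = G_v,toy`. [folklore] -/
theorem Gtoyv_mul_eq_one_num (ha : 16777216 ≤ a) (haB : 2 * a ≤ (B : ℝ)) (hv0 : ∀ x, 0 ≤ v x)
    (hv1 : ∀ x, v x ≤ 3 * (a / B) ^ 2) :
    Gtoyv n B ((a / B) ^ 2) ((a / B) ^ 2) v * (Lam n B ((a / B) ^ 2) + 0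
      + Dfw n B * (1 - Gv n B ((a / B) ^ 2) v * Qpt n B * (Ev n B ((a / B) ^ 2) v)⁻¹ * Qp n B
          * Gv n B ((a / B) ^ 2) v) * Dbw n B) = 1 := by
  have ha0 : 0 < a := by linarith
  have hBr : (0 : ℝ) < B := by linarith
  have hm : 0 < (a / B) ^ 2 := by positivity
  exact Gtoyv_mul_eq_one hm (isUnit_Ev_num ha haB hv0 hv1).1 (isUnit_MCv_num ha haB hv0 hv1).1

/-- the potential correction is relatively small: `t·R₁ = 3(a/B)²·R₁(a/B) ≤ 121` for `121 ≤ a ≤ B`. [folklore] -/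
theorem tR1_num_le (ha : 121 ≤ a) (haB : a ≤ (B : ℝ)) : 3 * (a / B) ^ 2 * R1 B (a / B) (1 / 2) ≤ 121 := by
  have ha0 : 0 < a := by linarith
  have ha1 : 0 < a - 1 := by linarith
  have ha1' : a - 1 ≠ 0 := ha1.ne'
  have hBr : (0 : ℝ) < B := by linarith
  calc 3 * (a / B) ^ 2 * R1 B (a / B) (1 / 2) ≤ 3 * (a / B) ^ 2 * (40 * (B : ℝ) ^ 2 / (a * (a - 1))) :=
        mul_le_mul_of_nonneg_left (R1_num_le (by linarith) haB) (by positivity)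
    _ = 120 * a / (a - 1) := by field_simp; ring
    _ ≤ 121 := by rw [div_le_iff₀ ha1]; linarith

/-- the size of the sequence-2 gradient norms: `R_D(1 + t·R₁) ≤ 54656·B/a` for `2²⁰ ≤ a ≤ B` (`448·122`).
[folklore] -/
theorem DGv_size (ha : 1048576 ≤ a) (haB : a ≤ (B : ℝ)) :
    RD B (a / B) (1 / 2) * (1 + 3 * (a / B) ^ 2 * R1 B (a / B) (1 / 2)) ≤ 54656 * B / a := by
  have ha0 : 0 < a := by linarith
  have hBr : (0 : ℝ) < B := by linarith
  have hsl : 0 < a / B / 2 - 1 / 2 / (B : ℝ) := by rw [srate_eq]; exact div_pos (div_pos (by linarith) hBr) two_pos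
  obtain ⟨-, hY, -⟩ := factor_sizes ha haB
  have ht := tR1_num_le (by linarith) haB
  have hR1 : 0 ≤ R1 B (a / B) (1 / 2) := (R1_pos (by positivity) hsl).le
  calc RD B (a / B) (1 / 2) * (1 + 3 * (a / B) ^ 2 * R1 B (a / B) (1 / 2)) ≤ (448 * B / a) * 122 :=
        mul_le_mul hY (by linarith) (by positivity) (by positivity)
    _ = 54656 * B / a := by ring

/-- `N(∂G_v) ≤ 54656·B/a` at `m = a/B`, `κ = 1/2`, `0 ≤ v ≤ 3(a/B)²`, `2²⁰ ≤ a ≤ B`. [folklore] -/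
theorem rowLe_DGv_num (ha : 1048576 ≤ a) (haB : a ≤ (B : ℝ)) (hv0 : ∀ x, 0 ≤ v x)
    (hv1 : ∀ x, v x ≤ 3 * (a / B) ^ 2) :
    RowLe (siteWt n B (1 / 2)) (Dfw n B * Gv n B ((a / B) ^ 2) v) (54656 * B / a) := by
  have ha0 : 0 < a := by linarith
  have hBr : (0 : ℝ) < B := by linarith
  have hB : 0 < B := by exact_mod_cast hBr
  have hm1 : a / B ≤ 1 := by rwa [div_le_one hBr]
  have hsm : 0 < a / B / 4 - 1 / 2 / (B : ℝ) := by rw [qrate_eq]; exact div_pos (div_pos (by linarith) hBr) four_pos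
  have hsl : 0 < a / B / 2 - 1 / 2 / (B : ℝ) := by rw [srate_eq]; exact div_pos (div_pos (by linarith) hBr) two_pos
  exact rowLe_mono (rowLe_DGv (by positivity) hm1 (by norm_num) hB hsm hsl hv0 hv1 (by positivity)) (DGv_size ha haB)

/-- `N(G_v∂*) ≤ 54656·B/a` likewise. [folklore] -/
theorem rowLe_GvD_num (ha : 1048576 ≤ a) (haB : a ≤ (B : ℝ)) (hv0 : ∀ x, 0 ≤ v x)
    (hv1 : ∀ x, v x ≤ 3 * (a / B) ^ 2) :
    RowLe (siteWt n B (1 / 2)) (Gv n B ((a / B) ^ 2) v * Dbw n B) (54656 * B / a) := by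
  have ha0 : 0 < a := by linarith
  have hBr : (0 : ℝ) < B := by linarith
  have hB : 0 < B := by exact_mod_cast hBr
  have hm1 : a / B ≤ 1 := by rwa [div_le_one hBr]
  have hsm : 0 < a / B / 4 - 1 / 2 / (B : ℝ) := by rw [qrate_eq]; exact div_pos (div_pos (by linarith) hBr) four_pos
  have hsl : 0 < a / B / 2 - 1 / 2 / (B : ℝ) := by rw [srate_eq]; exact div_pos (div_pos (by linarith) hBr) two_pos
  exact rowLe_mono (rowLe_GvD (by positivity) hm1 (by norm_num) hB hsm hsl hv0 hv1 (by positivity)) (DGv_size ha haB)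

/-- **`G′₂ = G_v((a/B)²) ∈ 𝒟(0, 2, 40/(a(a−1)))`** on the toy frame for `1 < a ≤ B`, `v ≥ 0`, `δ₀ ≤ 1/2` — the
`MTwo.mG'` SHAPE (domination by Toy9's `Gr_opDec_num`). [folklore] -/
theorem Gv_opDec_num (ha : 1 < a) (haB : a ≤ (B : ℝ)) (hv0 : ∀ x, 0 ≤ v x) (hδ : δ₀ ≤ 1 / 2) :
    OpDec (toyFrame n B N hN δ₀) Prod.fst Prod.fst id id 0 2 (40 / (a * (a - 1))) (Gv n B ((a / B) ^ 2) v) := by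
  have ha0 : 0 < a := by linarith
  have ha1 : 0 < a - 1 := by linarith
  have hBr : (0 : ℝ) < B := by linarith
  have hB : 0 < B := by exact_mod_cast hBr
  have hm1 : a / B ≤ 1 := by rw [div_le_one hBr]; exact haB
  have hs : 0 < a / B / 2 - 1 / 2 / (B : ℝ) := by rw [srate_eq]; positivity
  refine opDec_fine_of_rowLe (by norm_num) hδ (rowLe_Gv (by positivity) hm1 (by norm_num) hB hs hv0)
    (by positivity) ?_
  calc R1 B (a / B) (1 / 2) ≤ 40 * (B : ℝ) ^ 2 / (a * (a - 1)) := R1_num_le ha haB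
    _ = 40 / (a * (a - 1)) * (B : ℝ) ^ (2 : ℤ) := by rw [zpow_ofNat]; ring

/-- **`∂G′₂ = ∂G_v ∈ 𝒟(0, 1, 54656/a)`** on the toy frame for `2²⁰ ≤ a ≤ B`, `0 ≤ v ≤ 3(a/B)²`, `δ₀ ≤ 1/2` — the
`MTwo.mDG'` SHAPE. [folklore] -/
theorem DGv_opDec_num (ha : 1048576 ≤ a) (haB : a ≤ (B : ℝ)) (hv0 : ∀ x, 0 ≤ v x)
    (hv1 : ∀ x, v x ≤ 3 * (a / B) ^ 2) (hδ : δ₀ ≤ 1 / 2) :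
    OpDec (toyFrame n B N hN δ₀) Prod.fst Prod.fst id id 0 1 (54656 / a) (Dfw n B * Gv n B ((a / B) ^ 2) v) := by
  have ha0 : 0 < a := by linarith
  refine opDec_fine_of_rowLe (by norm_num) hδ (rowLe_DGv_num ha haB hv0 hv1) (by positivity) (le_of_eq ?_)
  rw [zpow_one]; ring

/-- **THE ROW NORM OF `G_v,toy`**: `N(G₂) ≤ 13·10¹⁴·B²/a²` for `2²⁴ ≤ a`, `2a ≤ B`, `0 ≤ v ≤ 3(a/B)²`
(`40 + 40·54656·256·54656·40 = 1 223 589 206 425 640 ≤ 13·10¹⁴`; B-powers `2 + 1 − 4 + 1 + 2 = 2`). [folklore] -/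
theorem rowLe_Gtoyv_num (ha : 16777216 ≤ a) (haB : 2 * a ≤ (B : ℝ)) (hv0 : ∀ x, 0 ≤ v x)
    (hv1 : ∀ x, v x ≤ 3 * (a / B) ^ 2) :
    RowLe (siteWt n B (1 / 2)) (Gtoyv n B ((a / B) ^ 2) ((a / B) ^ 2) v) (13 * 10 ^ 14 / a ^ 2 * (B : ℝ) ^ 2) := by
  have ha0 : 0 < a := by linarith
  have ha' : 1048576 ≤ a := by linarith
  have haB' : a ≤ (B : ℝ) := by linarith
  have hBr : (0 : ℝ) < B := by linarith
  have hB : 0 < B := by exact_mod_cast hBr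
  have hm0 : 0 < a / B := by positivity
  have hm1 : a / B ≤ 1 := by rwa [div_le_one hBr]
  have hsl : 0 < a / B / 2 - 1 / 2 / (B : ℝ) := by rw [srate_eq]; exact div_pos (div_pos (by linarith) hBr) two_pos
  obtain ⟨_, hMC⟩ := isUnit_MCv_num (n := n) ha haB hv0 hv1
  have hdv := dv_pos (a := a) (by linarith) hBr
  have hRM : 0 ≤ 4 * (dv B a)⁻¹ := by positivity
  have hRv : (0 : ℝ) ≤ 54656 * B / a := by positivity
  have h := rowLe_Gtoyv (n := n) hm0 hm1 (by norm_num) hB hsl (rowLe_DGv_num ha' haB' hv0 hv1)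
    (rowLe_GvD_num ha' haB' hv0 hv1) hRv hRM hMC
  obtain ⟨hX, -, -⟩ := factor_sizes ha' haB'
  have hZ := RMv_le (B := B) (a := a) (by linarith) hBr
  have hX0 : 0 ≤ R1 B (a / B) (1 / 2) / 2 := by have := R1_pos (B := B) hm0 hsl; positivity
  refine rowLe_mono h ?_
  calc R1 B (a / B) (1 / 2) / 2 + R1 B (a / B) (1 / 2) / 2 * (54656 * B / a) * (4 * (dv B a)⁻¹)
          * (54656 * B / a) * (R1 B (a / B) (1 / 2) / 2)
      ≤ 40 * (B : ℝ) ^ 2 / a ^ 2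
          + 40 * (B : ℝ) ^ 2 / a ^ 2 * (54656 * B / a) * (256 * a ^ 4 / (B : ℝ) ^ 4) * (54656 * B / a)
            * (40 * (B : ℝ) ^ 2 / a ^ 2) := by
        gcongr
    _ = (40 + 40 * 54656 * 256 * 54656 * 40) * (B : ℝ) ^ 2 / a ^ 2 := by field_simp
    _ ≤ 13 * 10 ^ 14 / a ^ 2 * (B : ℝ) ^ 2 := by
        rw [div_mul_eq_mul_div]
        exact div_le_div_of_nonneg_right (mul_le_mul_of_nonneg_right (by norm_num) (sq_nonneg _))
          (by positivity)

/-- **`G₂ = G_v,toy ∈ 𝒟(0, 2, 13·10¹⁴/a²)` ON THE TOY FRAME** for `2²⁴ ≤ a`, `2a ≤ B`, `0 ≤ v ≤ 3(a/B)²`,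
`δ₀ ≤ 1/2` — the `MTwo.mG` SHAPE. [folklore] -/
theorem Gtoyv_opDec_num (ha : 16777216 ≤ a) (haB : 2 * a ≤ (B : ℝ)) (hv0 : ∀ x, 0 ≤ v x)
    (hv1 : ∀ x, v x ≤ 3 * (a / B) ^ 2) (hδ : δ₀ ≤ 1 / 2) :
    OpDec (toyFrame n B N hN δ₀) Prod.fst Prod.fst id id 0 2 (13 * 10 ^ 14 / a ^ 2)
      (Gtoyv n B ((a / B) ^ 2) ((a / B) ^ 2) v) := by
  have ha0 : 0 < a := by linarith
  refine opDec_fine_of_rowLe (by norm_num) hδ (rowLe_Gtoyv_num ha haB hv0 hv1) (by positivity) (le_of_eq ?_)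
  rw [zpow_ofNat]

/-- **THE ROW NORM OF `∂*G_v,toy`**: `N(∂*G₂) ≤ 7·10¹⁵·B/a` for `2²⁴ ≤ a`, `2a ≤ B`, `0 ≤ v ≤ 3(a/B)²`
(`224 + 224·54656·256·54656·40 = 6 852 099 555 983 584 ≤ 7·10¹⁵`; B-powers `1 + 1 − 4 + 1 + 2 = 1`). [folklore] -/
theorem rowLe_DbwGtoyv_num (ha : 16777216 ≤ a) (haB : 2 * a ≤ (B : ℝ)) (hv0 : ∀ x, 0 ≤ v x)
    (hv1 : ∀ x, v x ≤ 3 * (a / B) ^ 2) :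
    RowLe (siteWt n B (1 / 2)) (Dbw n B * Gtoyv n B ((a / B) ^ 2) ((a / B) ^ 2) v) (7 * 10 ^ 15 / a * (B : ℝ)) := by
  have ha0 : 0 < a := by linarith
  have ha' : 1048576 ≤ a := by linarith
  have haB' : a ≤ (B : ℝ) := by linarith
  have hBr : (0 : ℝ) < B := by linarith
  have hB : 0 < B := by exact_mod_cast hBr
  have hm0 : 0 < a / B := by positivity
  have hm1 : a / B ≤ 1 := by rwa [div_le_one hBr]
  have hsm : 0 < a / B / 4 - 1 / 2 / (B : ℝ) := by rw [qrate_eq]; exact div_pos (div_pos (by linarith) hBr) four_pos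
  have hsl : 0 < a / B / 2 - 1 / 2 / (B : ℝ) := by rw [srate_eq]; exact div_pos (div_pos (by linarith) hBr) two_pos
  obtain ⟨_, hMC⟩ := isUnit_MCv_num (n := n) ha haB hv0 hv1
  have hdv := dv_pos (a := a) (by linarith) hBr
  have hRM : 0 ≤ 4 * (dv B a)⁻¹ := by positivity
  have hRv : (0 : ℝ) ≤ 54656 * B / a := by positivity
  have h := rowLe_DbwGtoyv (n := n) hm0 hm1 (by norm_num) hB hsm hsl (rowLe_DGv_num ha' haB' hv0 hv1)
    (rowLe_GvD_num ha' haB' hv0 hv1) hRv hRM hMC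
  obtain ⟨hX, hY, -⟩ := factor_sizes ha' haB'
  have hZ := RMv_le (B := B) (a := a) (by linarith) hBr
  have hX0 : 0 ≤ R1 B (a / B) (1 / 2) / 2 := by have := R1_pos (B := B) hm0 hsl; positivity
  have hY0 : 0 ≤ RD B (a / B) (1 / 2) / 2 := by have := RD_nonneg (B := B) hsm; positivity
  have hY2 : RD B (a / B) (1 / 2) / 2 ≤ 224 * B / a := by
    calc RD B (a / B) (1 / 2) / 2 ≤ (448 * B / a) / 2 := div_le_div_of_nonneg_right hY zero_le_two
      _ = 224 * B / a := by ring
  refine rowLe_mono h ?_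
  calc RD B (a / B) (1 / 2) / 2 + RD B (a / B) (1 / 2) / 2 * (54656 * B / a) * (4 * (dv B a)⁻¹)
          * (54656 * B / a) * (R1 B (a / B) (1 / 2) / 2)
      ≤ 224 * B / a
          + 224 * B / a * (54656 * B / a) * (256 * a ^ 4 / (B : ℝ) ^ 4) * (54656 * B / a)
            * (40 * (B : ℝ) ^ 2 / a ^ 2) := by
        gcongr
    _ = (224 + 224 * 54656 * 256 * 54656 * 40) * B / a := by field_simp
    _ ≤ 7 * 10 ^ 15 / a * (B : ℝ) := by
        rw [div_mul_eq_mul_div]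
        exact div_le_div_of_nonneg_right (mul_le_mul_of_nonneg_right (by norm_num) hBr.le) ha0.le

/-- **`∂*G₂ = ∂*G_v,toy ∈ 𝒟(0, 1, 7·10¹⁵/a)`** on the toy frame — the `MTwo.mDtG` SHAPE. [folklore] -/
theorem DbwGtoyv_opDec_num (ha : 16777216 ≤ a) (haB : 2 * a ≤ (B : ℝ)) (hv0 : ∀ x, 0 ≤ v x)
    (hv1 : ∀ x, v x ≤ 3 * (a / B) ^ 2) (hδ : δ₀ ≤ 1 / 2) :
    OpDec (toyFrame n B N hN δ₀) Prod.fst Prod.fst id id 0 1 (7 * 10 ^ 15 / a)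
      (Dbw n B * Gtoyv n B ((a / B) ^ 2) ((a / B) ^ 2) v) := by
  have ha0 : 0 < a := by linarith
  refine opDec_fine_of_rowLe (by norm_num) hδ (rowLe_DbwGtoyv_num ha haB hv0 hv1) (by positivity) (le_of_eq ?_)
  rw [zpow_one]

/-- the weights of the ONE constant `c = 256a⁴` (`2²⁴ ≤ a`): every per-slot constant of both sequences is below it.
[folklore] -/
theorem bundle_consts_v (ha : 16777216 ≤ a) :
    (1 : ℝ) ≤ 256 * a ^ 4 ∧ 3 * a ^ 4 ≤ 256 * a ^ 4 ∧ 128 * a ^ 4 ≤ 256 * a ^ 4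
      ∧ 13 * 10 ^ 14 / a ^ 2 ≤ 256 * a ^ 4 ∧ 7 * 10 ^ 15 / a ≤ 256 * a ^ 4 ∧ 54656 / a ≤ 256 * a ^ 4
      ∧ 40 / (a * (a - 1)) ≤ 256 * a ^ 4 := by
  have ha0 : (0 : ℝ) < a := by linarith
  have ha4 : (0 : ℝ) ≤ a ^ 4 := by positivity
  obtain ⟨h1, -, -, hGr, -, -⟩ := bundle_consts (a := a) (by linarith)
  have h3 : 3 * a ^ 4 ≤ 256 * a ^ 4 := by nlinarith
  refine ⟨h1.trans h3, h3, by nlinarith, ?_, ?_, ?_, hGr.trans h3⟩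
  · rw [div_le_iff₀ (by positivity)]
    calc (13 : ℝ) * 10 ^ 14 ≤ 256 * 16777216 ^ 4 * 16777216 ^ 2 := by norm_num
      _ ≤ 256 * a ^ 4 * a ^ 2 := by gcongr
  · rw [div_le_iff₀ ha0]
    calc (7 : ℝ) * 10 ^ 15 ≤ 256 * 16777216 ^ 4 * 16777216 := by norm_num
      _ ≤ 256 * a ^ 4 * a := by gcongr
  · rw [div_le_iff₀ ha0]
    calc (54656 : ℝ) ≤ 256 * 16777216 ^ 4 * 16777216 := by norm_num
      _ ≤ 256 * a ^ 4 * a := by gcongr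

end NumericV

/-! ## §6 Constant monotonicity of the sequence-1 bundle on the toy frame (validity-free) -/

section Mono

variable {n B : ℕ} {N : Finset (Fin n)} {hN : N.Nonempty} {δ₀ : ℝ}
variable {S₂ B₂ : Type} [Fintype S₂] [DecidableEq S₂] [Fintype B₂]

/-- the constant of the sequence-1 bundle `MOne` on the toy frame may be enlarged (`0 ≤ c ≤ c′`), slot by slot via
Toy9's `opDec_toy_mono` (no frame validity needed, unlike `MOne.mono`). [folklore] -/
theorem mOne_toy_mono {X : TwoSeq (Fin n × Fin B) (Fin n × Fin B) (Fin n) S₂ (Fin n) B₂} {c c' : ℝ}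
    (h : MOne (toyFrame n B N hN δ₀) X id Prod.fst Prod.fst id id c) (hc0 : 0 ≤ c) (hc : c ≤ c') :
    MOne (toyFrame n B N hN δ₀) X id Prod.fst Prod.fst id id c' where
  mQ := opDec_toy_mono h.mQ hc0 hc
  mG := opDec_toy_mono h.mG hc0 hc
  mDG' := opDec_toy_mono h.mDG' hc0 hc
  mQ't := opDec_toy_mono h.mQ't hc0 hc
  mC := opDec_toy_mono h.mC hc0 hc
  mQ' := opDec_toy_mono h.mQ' hc0 hc
  mG' := opDec_toy_mono h.mG' hc0 hc

end Mono

/-! ## §7 The POTENTIAL datum `Xpot`: the first `TwoSeq` inhabitant with `∂ ≠ 0` whose sequences differ -/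

section Pot

variable {n B : ℕ} {N : Finset (Fin n)} {hN : N.Nonempty} {δ₀ : ℝ}

/-- `2²⁴ ≤ a ⇒ 2²⁰ ≤ a`. [folklore] -/
theorem ha20_of {a : ℝ} (ha : 16777216 ≤ a) : 1048576 ≤ a := by linarith

/-- `2²⁴ ≤ a`, `2a ≤ B ⇒ a ≤ B`. [folklore] -/
theorem haB_of {a : ℝ} (ha : 16777216 ≤ a) (haB : 2 * a ≤ (B : ℝ)) : a ≤ (B : ℝ) := by linarith

/-- **THE POTENTIAL DATUM** `Xpot` (parametric in a site potential `0 ≤ v ≤ 3(a/B)²`; `2²⁴ ≤ a`, `2a ≤ B`): fine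
carriers sites = bonds = `Fin n × Fin B`, all four coarse carriers `Fin n`, `χ = ψ = 1`, `∂ = Dfw`, `∂* = Dbw`,
`Λ = Lam(μ)`, `Λ′ = μ·1`, `A₁ = A₂ = 0`, `Q = Q′ = Q′`, `Q* = Q′* = Qpt`, `μ = (a/B)²`; SEQUENCE 1 = Toy10's genuine
operators (`A′₁ = 0`, `G′₁ = G′(μ)`, `C₁ = E₂(μ)⁻¹`, `G₁ = Gtoy(μ,μ)`); SEQUENCE 2 = the potential ones
(`A′₂ = diag v`, `G′₂ = G_v`, `C₂ = E_v⁻¹`, `G₂ = G_v,toy`); the six inverse identities (LEFT for sequence 1 by Toy8's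
shapes, RIGHT for sequence 2 by §2/§4/§5 and `mul_eq_one_comm`).  The sequences DIFFER whenever `v ≢ 0`
(`Xpot_G'₂_ne_G'₁`).  OURS (typing + the identities). [folklore] -/
def Xpot (n B : ℕ) (a : ℝ) (v : Fin n × Fin B → ℝ) (ha : 16777216 ≤ a) (haB : 2 * a ≤ (B : ℝ))
    (hv0 : ∀ x, 0 ≤ v x) (hv1 : ∀ x, v x ≤ 3 * (a / B) ^ 2) :
    TwoSeq (Fin n × Fin B) (Fin n × Fin B) (Fin n) (Fin n) (Fin n) (Fin n) where
  χs := 1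
  χb := 1
  ψS := 1
  ψB := 1
  D := Dfw n B
  Dt := Dbw n B
  Λ := Lam n B ((a / B) ^ 2)
  Λ' := ((a / B) ^ 2 : ℝ) • (1 : Matrix (Fin n × Fin B) (Fin n × Fin B) ℝ)
  Q₁ := Qp n B
  Q₂ := Qp n B
  Qt₁ := Qpt n B
  Qt₂ := Qpt n B
  Q'₁ := Qp n B
  Q'₂ := Qp n B
  Q't₁ := Qpt n B
  Q't₂ := Qpt n B
  A₁ := 0
  A₂ := 0
  A'₁ := 0
  A'₂ := Matrix.diagonal v
  G'₁ := Gr n B ((a / B) ^ 2)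
  G'₂ := Gv n B ((a / B) ^ 2) v
  C₁ := (E2 n B ((a / B) ^ 2))⁻¹
  C₂ := (Ev n B ((a / B) ^ 2) v)⁻¹
  G₁ := Gtoy n B ((a / B) ^ 2) ((a / B) ^ 2)
  G₂ := Gtoyv n B ((a / B) ^ 2) ((a / B) ^ 2) v
  hG'₁ := Gr_hG'_shape (muB_pos (ha20_of ha) (haB_of ha haB))
  hG'₂ := Gv_hG'_shape (muB_pos (ha20_of ha) (haB_of ha haB)) hv0
  hC₁ := E2inv_hC_shape (isUnit_E2_num (by linarith) (haB_of ha haB)).1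
  hC₂ := Evinv_hC_shape (isUnit_Ev_num ha haB hv0 hv1).1
  hG₁ := Gtoy_mul_eq_one_num (ha20_of ha) (haB_of ha haB)
  hG₂ := mul_eq_one_comm.mp (Gtoyv_mul_eq_one_num ha haB hv0 hv1)

variable {a : ℝ} {v : Fin n × Fin B → ℝ} {ha : 16777216 ≤ a} {haB : 2 * a ≤ (B : ℝ)} {hv0 : ∀ x, 0 ≤ v x}
  {hv1 : ∀ x, v x ≤ 3 * (a / B) ^ 2}

/-- projection of the potential datum: `∂ = Dfw`. [folklore] -/
@[simp] theorem Xpot_D : (Xpot n B a v ha haB hv0 hv1).D = Dfw n B := rfl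
/-- projection of the potential datum: `∂* = Dbw`. [folklore] -/
@[simp] theorem Xpot_Dt : (Xpot n B a v ha haB hv0 hv1).Dt = Dbw n B := rfl
/-- projection of the potential datum: `Λ′ = μ·1`. [folklore] -/
@[simp] theorem Xpot_Λ' : (Xpot n B a v ha haB hv0 hv1).Λ'
    = ((a / B) ^ 2 : ℝ) • (1 : Matrix (Fin n × Fin B) (Fin n × Fin B) ℝ) := rfl
/-- projection of the potential datum: `Q₁ = Q′`. [folklore] -/
@[simp] theorem Xpot_Q₁ : (Xpot n B a v ha haB hv0 hv1).Q₁ = Qp n B := rfl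
/-- projection of the potential datum: `Q′₁ = Q′`. [folklore] -/
@[simp] theorem Xpot_Q'₁ : (Xpot n B a v ha haB hv0 hv1).Q'₁ = Qp n B := rfl
/-- projection of the potential datum: `Q′₂ = Q′`. [folklore] -/
@[simp] theorem Xpot_Q'₂ : (Xpot n B a v ha haB hv0 hv1).Q'₂ = Qp n B := rfl
/-- projection of the potential datum: `Q*₂ = Qpt`. [folklore] -/
@[simp] theorem Xpot_Qt₂ : (Xpot n B a v ha haB hv0 hv1).Qt₂ = Qpt n B := rfl
/-- projection of the potential datum: `Q′*₁ = Qpt`. [folklore] -/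
@[simp] theorem Xpot_Q't₁ : (Xpot n B a v ha haB hv0 hv1).Q't₁ = Qpt n B := rfl
/-- projection of the potential datum: `Q′*₂ = Qpt`. [folklore] -/
@[simp] theorem Xpot_Q't₂ : (Xpot n B a v ha haB hv0 hv1).Q't₂ = Qpt n B := rfl
/-- projection of the potential datum: `A′₁ = 0`. [folklore] -/
@[simp] theorem Xpot_A'₁ : (Xpot n B a v ha haB hv0 hv1).A'₁ = 0 := rfl
/-- projection of the potential datum: `A′₂ = diag v`. [folklore] -/
@[simp] theorem Xpot_A'₂ : (Xpot n B a v ha haB hv0 hv1).A'₂ = Matrix.diagonal v := rfl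
/-- projection of the potential datum: `G′₁ = G′(μ)`. [folklore] -/
@[simp] theorem Xpot_G'₁ : (Xpot n B a v ha haB hv0 hv1).G'₁ = Gr n B ((a / B) ^ 2) := rfl
/-- projection of the potential datum: `G′₂ = G_v`. [folklore] -/
@[simp] theorem Xpot_G'₂ : (Xpot n B a v ha haB hv0 hv1).G'₂ = Gv n B ((a / B) ^ 2) v := rfl
/-- projection of the potential datum: `C₁ = E₂⁻¹`. [folklore] -/
@[simp] theorem Xpot_C₁ : (Xpot n B a v ha haB hv0 hv1).C₁ = (E2 n B ((a / B) ^ 2))⁻¹ := rfl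
/-- projection of the potential datum: `C₂ = E_v⁻¹`. [folklore] -/
@[simp] theorem Xpot_C₂ : (Xpot n B a v ha haB hv0 hv1).C₂ = (Ev n B ((a / B) ^ 2) v)⁻¹ := rfl
/-- projection of the potential datum: `G₁ = Gtoy`. [folklore] -/
@[simp] theorem Xpot_G₁ : (Xpot n B a v ha haB hv0 hv1).G₁ = Gtoy n B ((a / B) ^ 2) ((a / B) ^ 2) := rfl
/-- projection of the potential datum: `G₂ = G_v,toy`. [folklore] -/
@[simp] theorem Xpot_G₂ : (Xpot n B a v ha haB hv0 hv1).G₂ = Gtoyv n B ((a / B) ^ 2) ((a / B) ^ 2) v := rfl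

/-- **THE SEQUENCES OF `Xpot` DIFFER in the multi-level slot** whenever `v ≢ 0`: `A′₂ ≠ A′₁`. [folklore] -/
theorem Xpot_A'₂_ne_A'₁ {x₀ : Fin n × Fin B} (hx : v x₀ ≠ 0) :
    (Xpot n B a v ha haB hv0 hv1).A'₂ ≠ (Xpot n B a v ha haB hv0 hv1).A'₁ := by
  rw [Xpot_A'₂, Xpot_A'₁]
  intro h
  have h' := congrFun (congrFun h x₀) x₀
  rw [Matrix.diagonal_apply_eq, Matrix.zero_apply] at h'
  exact hx h'

/-- **THE SEQUENCES OF `Xpot` DIFFER in the scalar propagator** whenever `v ≢ 0`: `G′₂ ≠ G′₁` (`Gv_ne_Gr`).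
[folklore] -/
theorem Xpot_G'₂_ne_G'₁ {x₀ : Fin n × Fin B} (hx : v x₀ ≠ 0) :
    (Xpot n B a v ha haB hv0 hv1).G'₂ ≠ (Xpot n B a v ha haB hv0 hv1).G'₁ := by
  rw [Xpot_G'₂, Xpot_G'₁]
  exact Gv_ne_Gr (muB_pos (ha20_of ha) (haB_of ha haB)) hv0 hx

/-- **(M) OF SEQUENCE 1 for the potential datum at the ONE constant `c = 256a⁴`** (`δ₀ ≤ 1/2`): Toy10's
`mOne_of_seq1` (seven `rfl`s, constant `3a⁴`) enlarged by §6. [folklore] -/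
theorem mOne_Xpot (hδ : δ₀ ≤ 1 / 2) :
    MOne (toyFrame n B N hN δ₀) (Xpot n B a v ha haB hv0 hv1) id Prod.fst Prod.fst id id (256 * a ^ 4) := by
  have ha0 : 0 < a := by linarith
  obtain ⟨-, h3, -⟩ := bundle_consts_v ha
  exact mOne_toy_mono (mOne_of_seq1 (Xpot n B a v ha haB hv0 hv1) rfl rfl rfl rfl rfl rfl rfl (ha20_of ha)
    (haB_of ha haB) hδ) (by positivity) h3

/-- **(M) OF SEQUENCE 2 for the potential datum at the ONE constant `c = 256a⁴`** with `∇ := 0`: the nine slots of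
`MTwo` — `mG` (`Gtoyv_opDec_num`), `mQt`/`mQ't` (`opDec_Qpt`), `mDtG` (`DbwGtoyv_opDec_num`), `mDvG` (zero), `mG'`
(`Gv_opDec_num`), `mDG'` (`DGv_opDec_num`), `mC` (`Ev_inv_opDec_num`), `mQ'` (`opDec_of_rowsum`), unified by
`opDec_toy_mono` and `bundle_consts_v`. [folklore] -/
theorem mTwo_Xpot (hδ : δ₀ ≤ 1 / 2) :
    MTwo (toyFrame n B N hN δ₀) (Xpot n B a v ha haB hv0 hv1) id Prod.fst Prod.fst Prod.fst id id
      (0 : Matrix (Fin n × Fin B) (Fin n × Fin B) ℝ) (256 * a ^ 4) := by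
  have ha0 : 0 < a := by linarith
  have hBr : (0 : ℝ) < B := by linarith
  have hB : 0 < B := by exact_mod_cast hBr
  obtain ⟨h1, -, hcC, hcG, hcDt, hcD, hcGr⟩ := bundle_consts_v ha
  exact
    { mG := opDec_toy_mono (Gtoyv_opDec_num ha haB hv0 hv1 hδ) (by positivity) hcG
      mQt := opDec_Qpt h1
      mDtG := opDec_toy_mono (DbwGtoyv_opDec_num ha haB hv0 hv1 hδ) (by positivity) hcDt
      mDvG := by
        rw [Matrix.zero_mul]
        exact opDec_zero_toy _ _ _ _ 0 1 (by positivity)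
      mG' := opDec_toy_mono (Gv_opDec_num (by linarith) (haB_of ha haB) hv0 hδ) (by
          have : 0 < a - 1 := by linarith
          positivity) hcGr
      mDG' := opDec_toy_mono (DGv_opDec_num (ha20_of ha) (haB_of ha haB) hv0 hv1 hδ) (by positivity) hcD
      mQ't := opDec_Qpt h1
      mC := opDec_toy_mono (Ev_inv_opDec_num ha haB hv0 hv1 hδ) (by positivity) hcC
      mQ' := opDec_of_rowsum (Qp_rowsum hB) h1 }

/-- THE CUT POTENTIAL: `vcut t I₀ (x) = t` on the blocks LEFT of `I₀`, `0` from block `I₀` on (a potential marking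
the left region of a cut at block `I₀`). OURS (typing). [folklore] -/
def vcut (n B : ℕ) (t : ℝ) (I₀ : ℕ) (x : Fin n × Fin B) : ℝ := if (x.1 : ℕ) < I₀ then t else 0

/-- [folklore] -/
theorem vcut_nonneg {t : ℝ} (ht : 0 ≤ t) (I₀ : ℕ) (x : Fin n × Fin B) : 0 ≤ vcut n B t I₀ x := by
  unfold vcut; split_ifs <;> linarith

/-- [folklore] -/
theorem vcut_le {t : ℝ} (ht : 0 ≤ t) (I₀ : ℕ) (x : Fin n × Fin B) : vcut n B t I₀ x ≤ t := by
  unfold vcut; split_ifs <;> linarith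

/-- [folklore] -/
theorem vcut_of_lt {t : ℝ} {I₀ : ℕ} {x : Fin n × Fin B} (h : (x.1 : ℕ) < I₀) : vcut n B t I₀ x = t := by
  unfold vcut; rw [if_pos h]

/-- [folklore] -/
theorem vcut_of_le {t : ℝ} {I₀ : ℕ} {x : Fin n × Fin B} (h : I₀ ≤ (x.1 : ℕ)) : vcut n B t I₀ x = 0 := by
  unfold vcut; rw [if_neg (not_lt.mpr h)]

/-- `0 ≤ 3(a/B)²`. [folklore] -/
theorem tcap_nonneg (a : ℝ) (B : ℕ) : 0 ≤ 3 * (a / B) ^ 2 := by positivity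

/-- **THE CUT DATUM** `Xcut I₀ := Xpot (vcut (3(a/B)²) I₀)`: sequence 2 carries the potential `3(a/B)²` on the blocks
left of `I₀` and agrees with sequence 1's data from block `I₀` on. OURS (typing). [folklore] -/
def Xcut (n B I₀ : ℕ) (a : ℝ) (ha : 16777216 ≤ a) (haB : 2 * a ≤ (B : ℝ)) :
    TwoSeq (Fin n × Fin B) (Fin n × Fin B) (Fin n) (Fin n) (Fin n) (Fin n) :=
  Xpot n B a (vcut n B (3 * (a / B) ^ 2) I₀) ha haB (vcut_nonneg (tcap_nonneg a B) I₀)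
    (vcut_le (tcap_nonneg a B) I₀)

/-- the cut datum's sequences DIFFER as soon as a site left of block `I₀` exists. [folklore] -/
theorem Xcut_G'₂_ne_G'₁ {I₀ : ℕ} {x₀ : Fin n × Fin B} (hx : (x₀.1 : ℕ) < I₀) :
    (Xcut n B I₀ a ha haB).G'₂ ≠ (Xcut n B I₀ a ha haB).G'₁ := by
  have ha0 : 0 < a := by linarith
  have hBr : (0 : ℝ) < B := by linarith
  have ht : (3 * (a / B) ^ 2 : ℝ) ≠ 0 := by positivity
  refine Xpot_G'₂_ne_G'₁ (x₀ := x₀) ?_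
  rw [vcut_of_lt hx]
  exact ht

/-- the bundles of the cut datum at `c = 256a⁴`. [folklore] -/
theorem mOne_Xcut {I₀ : ℕ} (hδ : δ₀ ≤ 1 / 2) :
    MOne (toyFrame n B N hN δ₀) (Xcut n B I₀ a ha haB) id Prod.fst Prod.fst id id (256 * a ^ 4) :=
  mOne_Xpot hδ

/-- [folklore] -/
theorem mTwo_Xcut {I₀ : ℕ} (hδ : δ₀ ≤ 1 / 2) :
    MTwo (toyFrame n B N hN δ₀) (Xcut n B I₀ a ha haB) id Prod.fst Prod.fst Prod.fst id id
      (0 : Matrix (Fin n × Fin B) (Fin n × Fin B) ℝ) (256 * a ^ 4) :=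
  mTwo_Xpot hδ

end Pot

end

end Literature.MathematicalPhysics.QuantumFieldTheory.Balaban1983to89.B9SectCDiffCutModelToy11
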